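import Literature.AlgebraicGeometry.Kawanoue2007.NonsingularityPrincipleLevelOne
import Literature.AlgebraicGeometry.KawanoueMatsuki2010.MuTildeIndependence
import Literature.AlgebraicGeometry.Resolution.AffineDomainEquidim
import Mathlib.Data.Fin.Tuple.Sort
import HarnessLib

/-!
# Kawanoue–Matsuki 2010 (IFP Part II), Theorem A.1.1.1 (1): the nonsingularity principle of the center with
# 𝔇-saturation only — PROVED (`exists_rsop_isLGS_generate`)

H. Kawanoue, K. Matsuki, *Toward resolution of singularities over a field of positive characteristic (the idealistic
filtration program), Part II*, Publ. RIMS 46 (2010) 359–422, arXiv:math/0612008 — Appendix A.1, Theorem A.1.1.1 (1)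
[chunk p0056 L11–L17]: «Let `𝕀` be an idealistic filtration of i.f.g. type which is 𝔇-saturated. Let `P ∈ Supp(𝕀)`
be a closed point [with `μ̃(P) = ∞`]. Then there exist a regular system of parameters `(x_1, …, x_d)` at `P`, a
nonnegative integer `N ≤ d` and nonnegative integers `e_1 ≤ ⋯ ≤ e_N` such that `ℍ = {(x_l^{p^{e_l}}, p^{e_l})}_{l=1}^N`
is an LGS of `𝕀_P` and `𝕀_P = G_{R_P}(ℍ)`.» This file proves it (`exists_rsop_isLGS_generate`, the statement of the
tree's named fact `KawanoueMatsuki2010_thm_A_1_1_1_part1` of `InvariantsAtClosedPoint.lean`, whose discharge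
`KawanoueMatsuki2010_thm_A_1_1_1_part1_holds` is one line from here), following the printed proof A.1.2 [chunks
p0057 L15 – p0062 L19] step by step:

* **Step 1** [p0057 L17 – p0058 L9] «`𝕀_P = G_{R_P}(ℍ)` for any LGS `ℍ`»: `level_le_iSup_span_hPow` — the Coefficient
  Lemma of Part I (tree theorem `Kawanoue2007.coefficientLemma`) with `μ → ∞` and Krull's intersection theorem, over
  any `R` of the Coefficient Lemma's setting.
* **Step 2** [p0058 L10–L44]: induction on the level `e_u`; the regular system of parameters adapted to `ℍ` is
  Part I Rem. 4.1.1.1 (3) (tree `Kawanoue2007.exists_rsop_sub_pow_mem`); one level is `exists_next_level`, the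
  induction `exists_rsop_isLGS_pow` (§§5–6).
* **Step 3** [p0058 L45 – p0061 L22], claim (◇) `(𝕀_P)_{p^{e_u}} ⊆ J_l = F^{e_u}(𝔪_P) + (X^{[C]} ; |[C]| ≥ p^{e_u})
  + (𝕀_P)_{p^{e_u}} ∩ 𝔪_P^{p^{e_u}+1} + 𝔪_P^l` for all `l`: `InJ`, `inJ_base` (the case `l = p^{e_u}+1`), `inJ_step`
  (the printed case analysis Case 1 / Subcases 1.1, 1.2 / Case 2 / Subcases 2.1, 2.2, 2.3 with the differential
  operators `∂_{z_ω^{v_{ω,r}}}`, `∂_{X^{[S_q]}}` — here the truncated Hasse–Schmidt system along the regular system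
  of parameters of `Resolution.exists_hasseSystem_of_span_eq_maximalIdeal` (EGA IV 16.11.2), `R^{p^{e_u}}`-linear by
  `Resolution.IsDiffOpLE.apply_pow_char_pow_mul'`, binomial coefficients by Lucas), `inJ_all`. The printed «power
  series expansion» arguments are replaced by initial forms in `gr_𝔪(R) = κ[X]` (quasi-regularity,
  `Resolution.map_residue_eq_zero_of_eval_mem_pow_succ`) and Part I Lemma 4.1.2.3 (tree theorem
  `Kawanoue2007.exists_coeff_mem_pow_of_mem_span_inter_pow`): `exists_le_of_mem_support`, `coeff_eq_zero_of_forall_lt`.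
  The coefficients `α_{ST} ∈ k` use that every residue class is represented in `k ⊂ R_P` (`k = k̄`):
  `exists_isHomogeneous_aeval_sub_mem`.
* **Step 4** [p0061 L23 – p0062 L19]: `exists_sub_pow_mem_tIdeal` — Krull's intersection theorem for the finite
  `F^{e_u}(R_P)`-module `R_P / (F^{e_u}(𝔪_P) + T)` (F-finiteness: tree `Hironaka2017.S02Preliminaries.isFFinite_of_essFiniteType`,
  Kunz; `𝔪_P^{l'} ⊆ 𝔪_S^l R_P`: `pow_le_map_maximalIdeal_pow`), then the leading form of `w` in `h_l = w^{p^{e_u}} + t`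
  (`exists_leading_coeffs`) and the replacement `h_l ↦ x'_{v l}^{p^{e_u}}` (`exists_next_level`; the invariance of
  `μ = ∞` under the change of LGS is Prop. 3.1.2.1, tree theorem `muTilde_eq_of_isLGS`).
* §7 puts `R_P = A_𝔫` (`A` smooth of finite type over `k = k̄`, `𝔫` maximal): `dim R_P = dim A`
  (`Resolution.height_eq_ringKrullDim_of_isMaximal`), the residue field is `k` (Nullstellensatz), the characteristic is
  `p` prime or `0` (`p = 1`, `exists_rsop_isLGS_pow_one`), and the indices are sorted (`Tuple.sort`) and the
  parameters permuted (`Equiv.extendSubtype`) into the fact's format `x ∘ Fin.castLE`.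

No new definitions of mathematical content (`lowIdeal`, `tIdeal`, `InJ`, `lowMulti`, `lowPart`, `binomJ`, `applyJ` are
bookkeeping abbreviations of the printed `(X^{[C]})`, `T`, `J_l`, `S_q`, `[S_q]`, `(S over J)`, `∂_J F`); no facts.

## References

* H. Kawanoue, K. Matsuki, IFP Part II, Publ. RIMS 46 (2010), arXiv:math/0612008, Appendix A.1. [KawanoueMatsuki2010]
* H. Kawanoue, IFP Part I, Publ. RIMS 43 (2007), arXiv:math/0607009, Ch. 4 (Rem. 4.1.1.1 (3), Lemma 4.1.2.3,
  Lemma 4.1.4.1, Thm. 4.2.1.1). [Kawanoue2007]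
* H. Matsumura, *Commutative Ring Theory* (1986/87), Thm. 8.10 (Krull), §14 (regular local rings). [Matsumura1987]
* E. Kunz, Characterizations of regular local rings of characteristic `p`, Amer. J. Math. 91 (1969), Thm. 2.1. [Kunz1969]
* A. Grothendieck, J. Dieudonné, ÉGA IV₄, 16.11.2 (Hasse–Schmidt operators along coordinates). [EGAIV4]
* E. Lucas' theorem on binomial coefficients (Mathlib `Choose.choose_modEq_choose_mod_mul_choose_div_nat`).
-/

noncomputable section

namespace Literature.AlgebraicGeometry.KawanoueMatsuki2010

open Literature.AlgebraicGeometry.Kawanoue2007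
open Literature.AlgebraicGeometry.Resolution
open Literature.RingTheory.HilbertSamuel (gradedPiece gradedPiece.mk)
open IsLocalRing MvPolynomial
open scoped ENNReal

universe u

/-! ## §1. Generalities: Lucas for prime powers, forms with coefficients in a coefficient field, reindexing of an LGS -/

section Lucas

/-- **Lucas' theorem for a prime power base**: `C(q a + b, q c + d) ≡ C(a, c) C(b, d) (mod p)` for `q = p^E`,
`b, d < q` (iterate Mathlib's one-digit Lucas). [cite: KawanoueMatsuki2010, Thm. A.1.1.1 (proof, Step 3: the
binomial coefficients of `∂_{z_ω^{v_{ω,r}}}`, `∂_{X^{[S_q]}}`, chunks p0059 L54 – p0061 L4)] -/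
theorem choose_mul_add_modEq {p : ℕ} [hp : Fact p.Prime] :
    ∀ (E a b c d : ℕ), b < p ^ E → d < p ^ E →
      (p ^ E * a + b).choose (p ^ E * c + d) ≡ a.choose c * b.choose d [MOD p]
  | 0, a, b, c, d, hb, hd => by
    simp only [pow_zero, Nat.lt_one_iff] at hb hd
    subst hb; subst hd; simp [Nat.ModEq.refl]
  | E + 1, a, b, c, d, hb, hd => by
    have hp0 : 0 < p := hp.out.pos
    -- one digit: `n = p (p^E a + b / p) + b % p`
    have e1 : p ^ (E + 1) * a + b = p * (p ^ E * a + b / p) + b % p := by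
      rw [pow_succ]; have := Nat.div_add_mod b p; nlinarith [this]
    have e2 : p ^ (E + 1) * c + d = p * (p ^ E * c + d / p) + d % p := by
      rw [pow_succ]; have := Nat.div_add_mod d p; nlinarith [this]
    have h1 := Choose.choose_modEq_choose_mod_mul_choose_div_nat (n := p ^ (E + 1) * a + b)
      (k := p ^ (E + 1) * c + d) (p := p)
    have hn1 : (p ^ (E + 1) * a + b) % p = b % p := by
      rw [e1, Nat.mul_add_mod]; exact Nat.mod_mod _ _
    have hn2 : (p ^ (E + 1) * a + b) / p = p ^ E * a + b / p := by
      rw [e1, Nat.mul_add_div hp0, Nat.div_eq_of_lt (Nat.mod_lt _ hp0), add_zero]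
    have hk1 : (p ^ (E + 1) * c + d) % p = d % p := by
      rw [e2, Nat.mul_add_mod]; exact Nat.mod_mod _ _
    have hk2 : (p ^ (E + 1) * c + d) / p = p ^ E * c + d / p := by
      rw [e2, Nat.mul_add_div hp0, Nat.div_eq_of_lt (Nat.mod_lt _ hp0), add_zero]
    rw [hn1, hn2, hk1, hk2] at h1
    have hb' : b / p < p ^ E := Nat.div_lt_of_lt_mul (by rw [← pow_succ']; exact hb)
    have hd' : d / p < p ^ E := Nat.div_lt_of_lt_mul (by rw [← pow_succ']; exact hd)
    have h2 := choose_mul_add_modEq E a (b / p) c (d / p) hb' hd'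
    have h3 := Choose.choose_modEq_choose_mod_mul_choose_div_nat (n := b) (k := d) (p := p)
    -- combine
    calc (p ^ (E + 1) * a + b).choose (p ^ (E + 1) * c + d)
        ≡ (b % p).choose (d % p) * (p ^ E * a + b / p).choose (p ^ E * c + d / p) [MOD p] := h1
      _ ≡ (b % p).choose (d % p) * (a.choose c * (b / p).choose (d / p)) [MOD p] := h2.mul_left _
      _ = a.choose c * ((b % p).choose (d % p) * (b / p).choose (d / p)) := by ring
      _ ≡ a.choose c * b.choose d [MOD p] := h3.symm.mul_left _

/-- `C(q a + b, b) ≡ 1 (mod p)` for `b < q = p^E` (Subcase 1.2: the coefficient of `∂_{z_ω^{v_{ω,r}}}`).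
[cite: KawanoueMatsuki2010, Thm. A.1.1.1 (proof, Step 3, Subcase 1.2, chunk p0059 L54–L58)] -/
theorem choose_mul_add_self_modEq_one {p : ℕ} [Fact p.Prime] (E a b : ℕ) (hb : b < p ^ E) :
    (p ^ E * a + b).choose b ≡ 1 [MOD p] := by
  have := choose_mul_add_modEq (p := p) E a b 0 b hb hb
  simpa using this

/-- `C(q a + b, q a) ≡ 1 (mod p)` for `b < q = p^E` (Subcase 2.3: the coefficient of `∂_{X^{[S_q]}}`).
[cite: KawanoueMatsuki2010, Thm. A.1.1.1 (proof, Step 3, Subcase 2.3, chunk p0061 L1–L4)] -/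
theorem choose_mul_add_mul_modEq_one {p : ℕ} [Fact p.Prime] (E a b : ℕ) (hb : b < p ^ E) :
    (p ^ E * a + b).choose (p ^ E * a) ≡ 1 [MOD p] := by
  have := choose_mul_add_modEq (p := p) E a b a 0 hb (pow_pos (Fact.out : p.Prime).pos E)
  simpa using this

end Lucas

section CoefficientField

variable {k : Type u} [Field k] {R : Type u} [CommRing R] [IsRegularLocalRing R] [Algebra k R]
  {d : ℕ} (hd : (maximalIdeal R).spanFinrank = d) (x : Fin d → R)
  (hx : Ideal.span (Set.range x) = maximalIdeal R)

/-- An element of `k ⊂ R` lying in `𝔪` is zero (a nonzero scalar is a unit). [folklore] -/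
private theorem eq_zero_of_algebraMap_mem {c : k} (hc : algebraMap k R c ∈ maximalIdeal R) : c = 0 := by
  by_contra h
  exact (IsLocalRing.mem_maximalIdeal _).mp hc ((isUnit_iff_ne_zero.mpr h).map (algebraMap k R))

include hx in
/-- A form of degree `m` over `k` evaluated at the regular system of parameters lies in `𝔪^m`. [folklore] -/
private theorem aeval_mem_pow {m : ℕ} {F : MvPolynomial (Fin d) k} (hF : F.IsHomogeneous m) :
    MvPolynomial.aeval x F ∈ maximalIdeal R ^ m := by
  rw [MvPolynomial.aeval_def, ← MvPolynomial.eval_map, ← hx]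
  exact (Ideal.mem_span_pow_iff_exists_isHomogeneous x _).mpr ⟨_, hF.map _, rfl⟩

include hx in
/-- **Forms with coefficients in the coefficient field** («we may choose `α_{ST} ∈ k`», chunk p0059 L31–L33): when
every residue class has a representative in `k ⊂ R`, every `m ∈ 𝔪^l` is, modulo `𝔪^{l+1}`, a form of degree `l`
in the regular system of parameters with coefficients in `k`.
[cite: KawanoueMatsuki2010, Thm. A.1.1.1 (proof, Step 3, chunk p0059 L31–L33)] -/
theorem exists_isHomogeneous_aeval_sub_mem
    (hk : ∀ r : R, ∃ c : k, r - algebraMap k R c ∈ maximalIdeal R) {l : ℕ} {m : R}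
    (hm : m ∈ maximalIdeal R ^ l) :
    ∃ F : MvPolynomial (Fin d) k, F.IsHomogeneous l ∧
      m - MvPolynomial.aeval x F ∈ maximalIdeal R ^ (l + 1) := by
  classical
  obtain ⟨G, hG, hGm⟩ := exists_isHomogeneous_eval_eq_of_mem_pow x hx hm
  choose c hc using hk
  refine ⟨∑ γ ∈ G.support, MvPolynomial.monomial γ (c (G.coeff γ)), ?_, ?_⟩
  · refine MvPolynomial.IsHomogeneous.sum _ _ _ fun γ hγ => MvPolynomial.isHomogeneous_monomial _ ?_
    rw [Finsupp.degree_eq_weight_one]; exact hG (MvPolynomial.mem_support_iff.mp hγ)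
  · have eG : MvPolynomial.eval x G = ∑ γ ∈ G.support, G.coeff γ * ∏ i, x i ^ γ i := by
      conv_lhs => rw [G.as_sum]
      rw [map_sum]
      refine Finset.sum_congr rfl fun γ _ => ?_
      rw [MvPolynomial.eval_monomial, Finsupp.prod_fintype _ _ fun i => pow_zero _]
    have eF : MvPolynomial.aeval x (∑ γ ∈ G.support, MvPolynomial.monomial γ (c (G.coeff γ))) =
        ∑ γ ∈ G.support, algebraMap k R (c (G.coeff γ)) * ∏ i, x i ^ γ i := by
      rw [map_sum]
      refine Finset.sum_congr rfl fun γ _ => ?_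
      rw [MvPolynomial.aeval_monomial, Finsupp.prod_fintype _ _ fun i => pow_zero _]
    rw [← hGm, eG, eF, ← Finset.sum_sub_distrib]
    refine sum_mem fun γ hγ => ?_
    have hdeg : γ.degree = l := by
      rw [Finsupp.degree_eq_weight_one]; exact hG (MvPolynomial.mem_support_iff.mp hγ)
    rw [← sub_mul, pow_succ']
    refine Ideal.mul_mem_mul (hc _) ?_
    have := Hironaka2017.S02Preliminaries.prod_pow_mem_span_pow x γ
    rwa [hx, hdeg] at this

include hd hx in
/-- **Monomials of a form evaluating into `Σ_i h_i 𝔪^{m − q_i} + 𝔪^{m+1}` are divisible by some `X_{v i}^{q_i}`**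
(«any monomial of degree `l − v_{ω,r}` that appears in the power series expansion of an element in
`Σ (h_{ij}) 𝔪_P^{l − v_{ω,r} − p^{e_i}}` … should be divisible by some `x_{ij}^{p^{e_i}}`», chunk p0060 L8–L12): if
`h_i ≡ x_{v i}^{q_i} (mod 𝔪^{q_i + 1})` and the form `Ψ` of degree `m` over `k ⊂ R` satisfies
`Ψ(x) ≡ Σ_i c_i h_i (mod 𝔪^{m+1})` with `c_i ∈ 𝔪^{m − q_i}`, then every exponent in the support of `Ψ` is `≥ q_i` at
`v i` for some `i` (the initial forms of the right-hand side lie in the monomial ideal `(X_{v i}^{q_i})` of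
`gr_𝔪(R) = κ[X]`). [cite: KawanoueMatsuki2010, Thm. A.1.1.1 (proof, Step 3, chunk p0060 L5–L14)] -/
theorem exists_le_of_mem_support {ι : Type*} [Fintype ι] (v : ι → Fin d) (qq : ι → ℕ) (h : ι → R)
    (hh : ∀ l, h l - x (v l) ^ qq l ∈ maximalIdeal R ^ (qq l + 1))
    {m : ℕ} {Ψ : MvPolynomial (Fin d) k} (hΨ : Ψ.IsHomogeneous m)
    {c : ι → R} (hc : ∀ l, c l ∈ maximalIdeal R ^ (m - qq l))
    (hmem : MvPolynomial.aeval x Ψ - ∑ l, c l * h l ∈ maximalIdeal R ^ (m + 1)) :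
    ∀ γ ∈ Ψ.support, ∃ l, qq l ≤ γ (v l) := by
  classical
  intro γ hγ
  by_contra hcon
  push Not at hcon
  have hxm : ∀ i, x i ∈ maximalIdeal R := fun i => hx ▸ Ideal.subset_span ⟨i, rfl⟩
  have hhl : ∀ l, h l ∈ maximalIdeal R ^ qq l := fun l => by
    have := add_mem (Ideal.pow_le_pow_right (Nat.le_succ _) (hh l))
      (Ideal.pow_mem_pow (hxm (v l)) (qq l))
    simpa using this
  -- forms `C_l` for the `c_l` with `q_l ≤ m`
  have hC : ∀ l, ∃ C : MvPolynomial (Fin d) R, C.IsHomogeneous (m - qq l) ∧ MvPolynomial.eval x C = c l :=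
    fun l => exists_isHomogeneous_eval_eq_of_mem_pow x hx (hc l)
  choose C hC hCc using hC
  set T := (Finset.univ : Finset ι).filter (fun l => qq l ≤ m) with hT
  set P : MvPolynomial (Fin d) R :=
    MvPolynomial.map (algebraMap k R) Ψ - ∑ l ∈ T, MvPolynomial.X (v l) ^ qq l * C l with hP
  have hPhom : P.IsHomogeneous m := by
    refine (hΨ.map _).sub (MvPolynomial.IsHomogeneous.sum _ _ _ fun l hl => ?_)
    have := (MvPolynomial.isHomogeneous_X_pow (R := R) (v l) (qq l)).mul (hC l)
    rwa [Nat.add_sub_cancel' (Finset.mem_filter.mp hl).2] at this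
  have hPeval : MvPolynomial.eval x P ∈ maximalIdeal R ^ (m + 1) := by
    have e1 : MvPolynomial.eval x P = (MvPolynomial.aeval x Ψ - ∑ l, c l * h l) +
        (∑ l ∈ T, c l * (h l - x (v l) ^ qq l) +
          ∑ l ∈ (Finset.univ : Finset ι).filter (fun l => ¬ qq l ≤ m), c l * h l) := by
      rw [hP, map_sub, MvPolynomial.eval_map, ← MvPolynomial.aeval_def, map_sum,
        ← Finset.sum_filter_add_sum_filter_not Finset.univ (fun l => qq l ≤ m)]
      simp only [map_mul, map_pow, MvPolynomial.eval_X, hCc, mul_sub, Finset.sum_sub_distrib]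
      have : ∑ l ∈ T, x (v l) ^ qq l * c l = ∑ l ∈ T, c l * x (v l) ^ qq l :=
        Finset.sum_congr rfl fun l _ => mul_comm _ _
      rw [this]; ring
    rw [e1]
    refine add_mem hmem (add_mem (sum_mem fun l hl => ?_) (sum_mem fun l hl => ?_))
    · have := Ideal.mul_mem_mul (hc l) (hh l)
      rw [← pow_add] at this
      exact Ideal.pow_le_pow_right (by have := (Finset.mem_filter.mp hl).2; omega) this
    · have hq : m + 1 ≤ qq l := by have := (Finset.mem_filter.mp hl).2; omega
      exact Ideal.mul_mem_left _ _ (Ideal.pow_le_pow_right hq (hhl l))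
  have hPres : MvPolynomial.map (residue R) P = 0 :=
    map_residue_eq_zero_of_eval_mem_pow_succ hd x hx hPhom hPeval
  -- compare the coefficients of `X^γ`
  have h1 := congrArg (MvPolynomial.coeff γ) hPres
  rw [MvPolynomial.coeff_map, MvPolynomial.coeff_zero, hP, MvPolynomial.coeff_sub, MvPolynomial.coeff_map,
    MvPolynomial.coeff_sum, Finset.sum_eq_zero fun l _ => ?_, sub_zero, residue_eq_zero_iff] at h1
  · exact MvPolynomial.mem_support_iff.mp hγ (eq_zero_of_algebraMap_mem h1)
  · rw [MvPolynomial.X_pow_eq_monomial, MvPolynomial.coeff_monomial_mul', if_neg]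
    rw [Finsupp.single_le_iff]; exact not_le.mpr (hcon l)

end CoefficientField

/-! ## §2. Step 1 in the abstract setting (`𝕀_a ⊆ (H^B ; |[B]| ≥ a)`), the target set `F^{E}(𝔪) + T + 𝔪^l` of
claim (◇), and its base case `l = p^E + 1` -/

section Krull

variable {S : Type*} [CommRing S] [IsLocalRing S]

/-- Krull's intersection theorem, element form: `x ∈ I + 𝔪^N` for all `N` implies `x ∈ I`. [folklore] -/
private theorem krull_mem_of_forall_mem_sup_pow [IsNoetherianRing S] {I : Ideal S} {x : S}
    (hx : ∀ N : ℕ, x ∈ I ⊔ maximalIdeal S ^ N) : x ∈ I := by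
  have hinf : (⨅ i : ℕ, maximalIdeal S ^ i • ⊤ : Submodule S (S ⧸ I)) = ⊥ :=
    Ideal.iInf_pow_smul_eq_bot_of_isLocalRing _ (maximalIdeal.isMaximal S).ne_top
  have hmem : Ideal.Quotient.mk I x ∈ (⨅ i : ℕ, maximalIdeal S ^ i • ⊤ : Submodule S (S ⧸ I)) := by
    rw [Submodule.mem_iInf]
    intro N
    obtain ⟨y, hy, m, hm, hyx⟩ := Submodule.mem_sup.mp (hx N)
    have e1 : Ideal.Quotient.mk I x = m • (1 : S ⧸ I) := by
      rw [← hyx, map_add, Ideal.Quotient.eq_zero_iff_mem.mpr hy, zero_add, Algebra.smul_def, mul_one]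
      rfl
    rw [e1]
    exact Submodule.smul_mem_smul hm Submodule.mem_top
  rw [hinf, Submodule.mem_bot, Ideal.Quotient.eq_zero_iff_mem] at hmem
  exact hmem

end Krull

section KeyInclusion

variable {k : Type u} [Field k] [PerfectField k] {R : Type u} [CommRing R] [IsRegularLocalRing R] [Algebra k R]
  [Algebra.EssFiniteType k R] [Algebra.FormallySmooth k R]
variable (p : ℕ) {ι : Type*} [Fintype ι] (h : ι → R) (e : ι → ℕ) (𝕀 : IdealisticFiltration R)

/-- **Step 1 in the abstract setting**: for a 𝔇-saturated filtration with a weak LGS of invariant `μ = ∞`,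
`𝕀_a ⊆ (H^B ; |[B]| ≥ a)` for every `a` — the inclusion `𝕀 ⊆ G(ℍ)` of Kawanoue 2007 Thm. 4.2.1.1 (1), by the
Coefficient Lemma with `μ → ∞` and Krull (the same argument as `Kawanoue2007_thm_4_2_1_1_generate_holds`, over any
`R` of the Coefficient Lemma's setting). [cite: KawanoueMatsuki2010, Thm. A.1.1.1 (proof, Step 1, chunk p0057 L17 –
p0058 L9); Kawanoue2007, Thm. 4.2.1.1 (1)] -/
theorem level_le_iSup_span_hPow [ExpChar R p] (hD : 𝕀.IsDSaturated k) (H : IsWeakLGS p 𝕀 h e)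
    (hμ : muTilde 𝕀 h = ⊤) (a : ℝ) : 𝕀.level a ≤ ⨆ (B : ι →₀ ℕ) (_ : a ≤ (bracketDeg p e B : ℝ)), Ideal.span {hPow h B} := by
  classical
  intro f hfa
  set I₀ : Ideal R := ⨆ (B : ι →₀ ℕ) (_ : a ≤ (bracketDeg p e B : ℝ)), Ideal.span {hPow h B} with hI₀
  refine krull_mem_of_forall_mem_sup_pow fun N => ?_
  rcases le_or_gt a 0 with ha | ha
  · refine Ideal.mem_sup_left ?_
    have h1 : (1 : R) ∈ I₀ := by
      refine Ideal.mem_iSup_of_mem 0 (Ideal.mem_iSup_of_mem ?_ ?_)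
      · simpa using ha
      · simp
    simpa using I₀.mul_mem_left f h1
  set m₀ : ℕ := ⌈a⌉₊ - 1 with hm₀
  have hm₀a : (m₀ : ℝ) < a := by
    have h1 := Nat.ceil_lt_add_one ha.le
    have h2 : 1 ≤ ⌈a⌉₊ := Nat.one_le_iff_ne_zero.mpr (Nat.pos_iff_ne_zero.mp (Nat.ceil_pos.mpr ha))
    have h3 : ((⌈a⌉₊ - 1 : ℕ) : ℝ) = (⌈a⌉₊ : ℝ) - 1 := by
      rw [Nat.cast_sub h2, Nat.cast_one]
    rw [hm₀, h3]; linarith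
  set δ : ℝ := a - m₀ with hδ
  have hδ0 : 0 < δ := by rw [hδ]; linarith
  set μ : ℝ := N / δ with hμdef
  have hμ0 : 0 ≤ μ := div_nonneg (Nat.cast_nonneg N) hδ0.le
  have hμlt : ENNReal.ofReal μ < muTilde 𝕀 h := by rw [hμ]; exact ENNReal.ofReal_lt_top
  have hCL := coefficientLemma (k := k) p h e 𝕀 hD H hμ0 hμlt a
  rw [hCL] at hfa
  refine (show qIdeal p h e 𝕀 μ a ≤ I₀ ⊔ maximalIdeal R ^ N from iSup_le fun B => ?_) hfa
  by_cases hB : a ≤ (bracketDeg p e B : ℝ)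
  · have hBI : Ideal.span {hPow h B} ≤ I₀ := by
      rw [hI₀]; exact le_iSup₂_of_le B hB le_rfl
    exact Ideal.mul_le_left.trans (hBI.trans le_sup_left)
  · refine Ideal.mul_le_right.trans ((levelCut_le_pow 𝕀 μ _).trans
      ((Ideal.pow_le_pow_right ?_).trans le_sup_right))
    rw [not_le] at hB
    have hBm : bracketDeg p e B ≤ m₀ := by
      have : bracketDeg p e B < ⌈a⌉₊ := by
        by_contra hcon
        rw [not_lt] at hcon
        have : (⌈a⌉₊ : ℝ) ≤ bracketDeg p e B := by exact_mod_cast hcon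
        linarith [Nat.le_ceil a]
      omega
    have hge : δ ≤ a - bracketDeg p e B := by
      have : (bracketDeg p e B : ℝ) ≤ m₀ := by exact_mod_cast hBm
      rw [hδ]; linarith
    have hN : (N : ℝ) ≤ μ * (a - bracketDeg p e B) := by
      calc (N : ℝ) = μ * δ := by rw [hμdef, div_mul_cancel₀ _ hδ0.ne']
        _ ≤ μ * (a - bracketDeg p e B) := mul_le_mul_of_nonneg_left hge hμ0
    calc N = ⌈(N : ℝ)⌉₊ := (Nat.ceil_natCast N).symm
      _ ≤ ⌈μ * (a - bracketDeg p e B)⌉₊ := Nat.ceil_mono hN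

variable (E : ℕ)

/-- The ideal `(X^{[C]} ; |[C]| ≥ p^{e_u})` of monomials in the LGS elements of level `< e_u = E`
(`X^{[C]} = ∏ h_l^{c_l} = ∏ x_{v l}^{p^{e_l} c_l}` once the lower levels are exact powers).
[cite: KawanoueMatsuki2010, Thm. A.1.1.1 (proof, Step 3, definition of `J_l`, chunk p0058 L47 – p0059 L4)] -/
def lowIdeal : Ideal R :=
  ⨆ (B : ι →₀ ℕ) (_ : ∀ l ∈ B.support, e l < E) (_ : p ^ E ≤ bracketDeg p e B), Ideal.span {hPow h B}

/-- The ideal `T = (X^{[C]} ; |[C]| ≥ p^{e_u}) + (𝕀_P)_{p^{e_u}} ∩ 𝔪_P^{p^{e_u}+1}`: the two ideal summands of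
`J_l = F^{e_u}(𝔪_P) + (X^{[C]}) + (𝕀_P)_{p^{e_u}} ∩ 𝔪_P^{p^{e_u}+1} + 𝔪_P^l`.
[cite: KawanoueMatsuki2010, Thm. A.1.1.1 (proof, Step 3, definition of `J_l`, chunk p0058 L47 – p0059 L4)] -/
def tIdeal : Ideal R :=
  lowIdeal p h e E ⊔ (𝕀.level ((p ^ E : ℕ) : ℝ) ⊓ maximalIdeal R ^ (p ^ E + 1))

/-- Membership in `J_l = F^{e_u}(𝔪_P) + T + 𝔪_P^l` (a subgroup, not an ideal: `F^{e_u}(𝔪_P)` is the SET of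
`p^{e_u}`-th powers of elements of `𝔪_P`). [cite: KawanoueMatsuki2010, Thm. A.1.1.1 (proof, Step 3, claim (◇),
chunk p0059 L5–L12)] -/
def InJ (l : ℕ) (g : R) : Prop :=
  ∃ w ∈ maximalIdeal R, ∃ t ∈ tIdeal p h e 𝕀 E, g - w ^ p ^ E - t ∈ maximalIdeal R ^ l

variable {p h e 𝕀 E}

omit [IsRegularLocalRing R] in
/-- `(X^{[C]} ; |[C]| ≥ q) ⊆ 𝕀_q`. [cite: KawanoueMatsuki2010, Thm. A.1.1.1 (proof, Step 3, chunk p0058 L47 – p0059 L4)] -/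
theorem lowIdeal_le_level (hlev : ∀ l, h l ∈ 𝕀.level ((p ^ e l : ℕ) : ℝ)) :
    lowIdeal p h e E ≤ 𝕀.level ((p ^ E : ℕ) : ℝ) := by
  refine iSup_le fun B => iSup_le fun _ => iSup_le fun hB => ?_
  rw [Ideal.span_singleton_le_iff_mem]
  exact 𝕀.mem_of_le (by exact_mod_cast hB) (hPow_mem_level p h e 𝕀 hlev B)

/-- `T ⊆ 𝕀_q`. [cite: KawanoueMatsuki2010, Thm. A.1.1.1 (proof, Step 3, chunk p0058 L47 – p0059 L4)] -/
theorem tIdeal_le_level (hlev : ∀ l, h l ∈ 𝕀.level ((p ^ e l : ℕ) : ℝ)) :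
    tIdeal p h e 𝕀 E ≤ 𝕀.level ((p ^ E : ℕ) : ℝ) :=
  sup_le (lowIdeal_le_level hlev) inf_le_left

omit [IsRegularLocalRing R] in
/-- `X^{[C]} ∈ (X^{[C]} ; |[C]| ≥ q)`. [cite: KawanoueMatsuki2010, Thm. A.1.1.1 (proof, Step 3, chunk p0058 L47 – p0059 L4)] -/
theorem hPow_mem_lowIdeal {B : ι →₀ ℕ} (hB : ∀ l ∈ B.support, e l < E) (hq : p ^ E ≤ bracketDeg p e B) :
    hPow h B ∈ lowIdeal p h e E :=
  Ideal.mem_iSup_of_mem B (Ideal.mem_iSup_of_mem hB (Ideal.mem_iSup_of_mem hq (Ideal.mem_span_singleton_self _)))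

/-- `0 ∈ J_l`. [cite: KawanoueMatsuki2010, Thm. A.1.1.1 (proof, Step 3, claim (◇): `J_l` is a subgroup containing `T` and `𝔪_P^l`, chunk p0059 L5–L12)] -/
theorem InJ.zero [Fact p.Prime] (l : ℕ) : InJ p h e 𝕀 E l 0 :=
  ⟨0, zero_mem _, 0, zero_mem _, by
    rw [zero_pow (pow_ne_zero _ (Fact.out : p.Prime).ne_zero)]; simp⟩

/-- `J_l` is closed under addition (`w^q + w'^q = (w + w')^q`). [cite: KawanoueMatsuki2010, Thm. A.1.1.1 (proof, Step 3, claim (◇): `J_l` is a subgroup containing `T` and `𝔪_P^l`, chunk p0059 L5–L12)] -/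
theorem InJ.add [ExpChar R p] {l : ℕ} {g g' : R} (hg : InJ p h e 𝕀 E l g) (hg' : InJ p h e 𝕀 E l g') :
    InJ p h e 𝕀 E l (g + g') := by
  obtain ⟨w, hw, t, ht, hm⟩ := hg
  obtain ⟨w', hw', t', ht', hm'⟩ := hg'
  refine ⟨w + w', add_mem hw hw', t + t', add_mem ht ht', ?_⟩
  rw [add_pow_expChar_pow (p := p) w w' E]  -- `(w + w')^{p^E} = w^{p^E} + w'^{p^E}`
  convert add_mem hm hm' using 1; ring

/-- `J_l` is closed under finite sums. [cite: KawanoueMatsuki2010, Thm. A.1.1.1 (proof, Step 3, claim (◇): `J_l` is a subgroup containing `T` and `𝔪_P^l`, chunk p0059 L5–L12)] -/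
theorem InJ.sum [Fact p.Prime] [ExpChar R p] {α : Type*} {l : ℕ} {s : Finset α} {g : α → R}
    (hg : ∀ a ∈ s, InJ p h e 𝕀 E l (g a)) :
    InJ p h e 𝕀 E l (∑ a ∈ s, g a) := by
  classical
  induction s using Finset.induction_on with
  | empty => simpa using InJ.zero l
  | insert a s ha ih =>
    rw [Finset.sum_insert ha]
    exact (hg a (Finset.mem_insert_self _ _)).add (ih fun b hb => hg b (Finset.mem_insert_of_mem hb))

/-- `T ⊆ J_l`. [cite: KawanoueMatsuki2010, Thm. A.1.1.1 (proof, Step 3, claim (◇): `J_l` is a subgroup containing `T` and `𝔪_P^l`, chunk p0059 L5–L12)] -/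
theorem InJ.of_mem_tIdeal [Fact p.Prime] {l : ℕ} {t : R} (ht : t ∈ tIdeal p h e 𝕀 E) : InJ p h e 𝕀 E l t :=
  ⟨0, zero_mem _, t, ht, by rw [zero_pow (pow_ne_zero _ (Fact.out : p.Prime).ne_zero)]; simp⟩

/-- `𝔪_P^l ⊆ J_l`. [cite: KawanoueMatsuki2010, Thm. A.1.1.1 (proof, Step 3, claim (◇): `J_l` is a subgroup containing `T` and `𝔪_P^l`, chunk p0059 L5–L12)] -/
theorem InJ.of_mem_pow [Fact p.Prime] {l : ℕ} {m : R} (hm : m ∈ maximalIdeal R ^ l) : InJ p h e 𝕀 E l m :=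
  ⟨0, zero_mem _, 0, zero_mem _, by rw [zero_pow (pow_ne_zero _ (Fact.out : p.Prime).ne_zero)]; simpa⟩

/-- `J_l ⊆ J_{l'}` for `l' ≤ l`. [cite: KawanoueMatsuki2010, Thm. A.1.1.1 (proof, Step 3, claim (◇): `J_l` is a subgroup containing `T` and `𝔪_P^l`, chunk p0059 L5–L12)] -/
theorem InJ.mono {l l' : ℕ} (hl : l' ≤ l) {g : R} (hg : InJ p h e 𝕀 E l g) : InJ p h e 𝕀 E l' g := by
  obtain ⟨w, hw, t, ht, hm⟩ := hg
  exact ⟨w, hw, t, ht, Ideal.pow_le_pow_right hl hm⟩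

omit [Algebra.EssFiniteType k R] [Algebra.FormallySmooth k R] in
/-- `α · w^{q} ∈ F^{E}(𝔪)` for `α ∈ k` (perfect) and `w ∈ 𝔪`: `α w^q = (α^{1/q} w)^q`. [cite: KawanoueMatsuki2010,
Thm. A.1.1.1 (proof, Step 3, Subcase 1.1 «recall k is algebraically closed», chunk p0059 L50–L52)] -/
theorem InJ.algebraMap_mul_pow [ExpChar k p] (l : ℕ) (c : k) {w : R} (hw : w ∈ maximalIdeal R) :
    InJ p h e 𝕀 E l (algebraMap k R c * w ^ p ^ E) := by
  set c' : k := (iterateFrobeniusEquiv k p E).symm c with hc'def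
  have hc' : c' ^ p ^ E = c := by
    rw [← iterateFrobeniusEquiv_def, hc'def, RingEquiv.apply_symm_apply]
  refine ⟨algebraMap k R c' * w, Ideal.mul_mem_left _ _ hw, 0, zero_mem _, ?_⟩
  rw [mul_pow, ← map_pow, hc']
  simp

variable (p h e 𝕀 E) in
/-- **Base case of claim (◇)**: `(𝕀_P)_{p^{e_u}} ⊆ J_{p^{e_u}+1}` («since `μ(P) = ∞` implies …», chunk p0059
L13–L18): by Step 1, `𝕀_q ⊆ (H^B ; |[B]| ≥ q)`; a generator `H^B` either involves only lower indices (then it is an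
`X^{[C]}`), or an index of level `> e_u` or two factors (then it lies in `𝕀_q ∩ 𝔪^{q+1}`), or it is an `h_l` of
level `e_u`, `≡ x_{v l}^{q} (mod 𝔪^{q+1})`; coefficients `r = λ + m'` (`λ ∈ k`) give `λ x^q ∈ F^{e_u}(𝔪)` and
`m' x^q ∈ 𝔪^{q+1}`. [cite: KawanoueMatsuki2010, Thm. A.1.1.1 (proof, Step 3, chunk p0059 L13–L18)] -/
theorem inJ_base [Fact p.Prime] [ExpChar k p] [ExpChar R p]
    {d : ℕ} (x : Fin d → R) (hx : Ideal.span (Set.range x) = maximalIdeal R) (v : ι → Fin d)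
    (hk : ∀ r : R, ∃ c : k, r - algebraMap k R c ∈ maximalIdeal R)
    (hD : 𝕀.IsDSaturated k) (H : IsWeakLGS p 𝕀 h e) (hμ : muTilde 𝕀 h = ⊤)
    (hh : ∀ l, h l - x (v l) ^ p ^ e l ∈ maximalIdeal R ^ (p ^ e l + 1))
    {g : R} (hg : g ∈ 𝕀.level ((p ^ E : ℕ) : ℝ)) : InJ p h e 𝕀 E (p ^ E + 1) g := by
  classical
  have hp : 0 < p := (Fact.out : p.Prime).pos
  have hxm : ∀ i, x i ∈ maximalIdeal R := fun i => hx ▸ Ideal.subset_span ⟨i, rfl⟩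
  -- the honest ideal `𝒥₀ = (x_{v l}^q ; e_l = E) + T + 𝔪^{q+1}` containing `(H^B ; |[B]| ≥ q)`
  set f : ι → R := fun l => if e l = E then x (v l) ^ p ^ E else 0 with hf
  set J₀ : Ideal R := Ideal.span (Set.range f) ⊔ tIdeal p h e 𝕀 E ⊔ maximalIdeal R ^ (p ^ E + 1) with hJ₀
  have hgen : ∀ B : ι →₀ ℕ, ((p ^ E : ℕ) : ℝ) ≤ (bracketDeg p e B : ℝ) → hPow h B ∈ J₀ := by
    intro B hB
    have hB' : p ^ E ≤ bracketDeg p e B := by exact_mod_cast hB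
    by_cases hlow : ∀ l ∈ B.support, e l < E
    · exact Ideal.mem_sup_left (Ideal.mem_sup_right (Ideal.mem_sup_left (hPow_mem_lowIdeal hlow hB')))
    push Not at hlow
    obtain ⟨l₀, hl₀, hE⟩ := hlow
    have hBl₀ : 1 ≤ B l₀ := Nat.one_le_iff_ne_zero.mpr (Finsupp.mem_support_iff.mp hl₀)
    -- `H^B = h_{l₀} · H^{B − ε_{l₀}}`
    have eB : B = Finsupp.single l₀ 1 + (B - Finsupp.single l₀ 1) := by
      ext l; by_cases hl : l = l₀
      · subst hl; simp; omega
      · simp [Ne.symm hl]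
    have hlevq : h l₀ ∈ 𝕀.level ((p ^ E : ℕ) : ℝ) :=
      𝕀.mem_of_le (by exact_mod_cast Nat.pow_le_pow_right hp hE) (H.level_mem l₀)
    by_cases hrest : B - Finsupp.single l₀ 1 = 0
    · -- `B = ε_{l₀}`
      have eB1 : B = Finsupp.single l₀ 1 := by rw [eB, hrest, add_zero]
      rw [eB1, hPow_single, pow_one]
      rcases hE.lt_or_eq with hlt | heq
      · -- level `> E`: `h_{l₀} ∈ 𝕀_q ∩ 𝔪^{q+1} ⊆ T`
        refine Ideal.mem_sup_left (Ideal.mem_sup_right (Ideal.mem_sup_right ⟨hlevq, ?_⟩))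
        refine Ideal.pow_le_pow_right ?_ (H.pow_mem l₀)
        calc p ^ E + 1 ≤ p ^ (E + 1) := by
              rw [pow_succ]; have := Nat.one_lt_pow (n := 1) one_ne_zero (Fact.out : p.Prime).one_lt
              nlinarith [Nat.one_le_pow E p hp, (Fact.out : p.Prime).two_le]
          _ ≤ p ^ e l₀ := Nat.pow_le_pow_right hp hlt
      · -- level `= E`: `h_{l₀} = x_{v l₀}^q + (h_{l₀} − x^q)`
        have e1 : h l₀ = f l₀ + (h l₀ - x (v l₀) ^ p ^ e l₀) := by rw [hf]; simp [heq.symm]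
        rw [e1]
        refine add_mem (Ideal.mem_sup_left (Ideal.mem_sup_left (Ideal.subset_span ⟨l₀, rfl⟩)))
          (Ideal.mem_sup_right ?_)
        rw [heq]; exact hh l₀
    · -- two factors: `H^B ∈ h_{l₀} 𝔪 ⊆ 𝕀_q ∩ 𝔪^{q+1}`
      have hm1 : hPow h (B - Finsupp.single l₀ 1) ∈ maximalIdeal R := by
        have := hPow_mem_pow p h e H.pow_mem (B - Finsupp.single l₀ 1)
        exact Ideal.pow_le_self (Nat.pos_iff_ne_zero.mp (bracketDeg_pos p e hp hrest)) this
      rw [eB, hPow_add, hPow_single, pow_one]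
      refine Ideal.mem_sup_left (Ideal.mem_sup_right (Ideal.mem_sup_right ⟨Ideal.mul_mem_right _ _ hlevq, ?_⟩))
      rw [pow_succ]
      exact Ideal.mul_mem_mul (Ideal.pow_le_pow_right (Nat.pow_le_pow_right hp hE) (H.pow_mem l₀)) hm1
  have hgJ : g ∈ J₀ := by
    refine (show (⨆ (B : ι →₀ ℕ) (_ : ((p ^ E : ℕ) : ℝ) ≤ (bracketDeg p e B : ℝ)), Ideal.span {hPow h B}) ≤ J₀
      from iSup₂_le fun B hB => (Ideal.span_singleton_le_iff_mem _).mpr (hgen B hB))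
      (level_le_iSup_span_hPow p h e 𝕀 hD H hμ _ hg)
  -- read off `g = Σ_l r_l x_{v l}^q + t + m`
  rw [hJ₀] at hgJ
  obtain ⟨y, hy, m, hm, rfl⟩ := Submodule.mem_sup.mp hgJ
  obtain ⟨z, hz, t, ht, rfl⟩ := Submodule.mem_sup.mp hy
  refine InJ.add (InJ.add ?_ (InJ.of_mem_tIdeal ht)) (InJ.of_mem_pow hm)
  obtain ⟨r, rfl⟩ := Ideal.mem_span_range_iff_exists_fun.mp hz
  refine InJ.sum fun l _ => ?_
  by_cases hl : e l = E
  · simp only [hf, hl, if_true]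
    obtain ⟨c, hc⟩ := hk (r l)
    have e1 : r l * x (v l) ^ p ^ E =
        algebraMap k R c * x (v l) ^ p ^ E + (r l - algebraMap k R c) * x (v l) ^ p ^ E := by ring
    rw [e1]
    refine (InJ.algebraMap_mul_pow _ c (hxm _)).add (InJ.of_mem_pow ?_)
    rw [pow_succ']
    exact Ideal.mul_mem_mul hc (Ideal.pow_mem_pow (hxm _) _)
  · simp only [hf, hl, if_false, mul_zero]; exact InJ.zero _

end KeyInclusion

/-! ## §3. The inductive step of claim (◇): bookkeeping of exponents and the operators `∂_{X^{[S_q]}}`,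
`∂_{z_ω^{v_{ω,r}}}` -/

section LowPart

variable {ι : Type*} [Fintype ι] (p : ℕ) (e : ι → ℕ) {d : ℕ} (v : ι → Fin d) (E : ℕ)

/-- `S_q` of an exponent `S = [S_q] + S_r` (chunk p0059 L36–L41), restricted to the indices of level `< e_u`:
`(S_q)_l = ⌊γ_{v l} / p^{e_l}⌋` for `e_l < E`, `0` otherwise. [cite: KawanoueMatsuki2010, Thm. A.1.1.1 (proof, Step 3,
chunk p0059 L36–L41)] -/
def lowMulti (γ : Fin d →₀ ℕ) : ι →₀ ℕ :=
  Finsupp.equivFunOnFinite.symm fun l => if e l < E then γ (v l) / p ^ e l else 0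

/-- Unfolding of `lowMulti`. [cite: KawanoueMatsuki2010, Thm. A.1.1.1 (proof, Step 3, chunk p0059 L36–L41)] -/
@[simp] theorem lowMulti_apply (γ : Fin d →₀ ℕ) (l : ι) :
    lowMulti p e v E γ l = if e l < E then γ (v l) / p ^ e l else 0 := by
  simp [lowMulti]

/-- `[S_q]` (chunk p0059 L36–L41) on the indices of level `< e_u`: the exponent `Σ_l p^{e_l} (S_q)_l ε_{v l}`.
[cite: KawanoueMatsuki2010, Thm. A.1.1.1 (proof, Step 3, chunk p0059 L36–L41)] -/
def lowPart (γ : Fin d →₀ ℕ) : Fin d →₀ ℕ :=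
  ∑ l, Finsupp.single (v l) (p ^ e l * lowMulti p e v E γ l)

omit [Fintype ι] in
/-- `∏_t y_t^{(Σ_{l ∈ s} a_l ε_{v l})_t} = ∏_{l ∈ s} y_{v l}^{a_l}`. [folklore] -/
private theorem prod_pow_sum_single {M : Type*} [CommMonoid M] (y : Fin d → M) (s : Finset ι) (a : ι → ℕ) :
    ∏ t, y t ^ ((∑ l ∈ s, Finsupp.single (v l) (a l)) t) = ∏ l ∈ s, y (v l) ^ a l := by
  classical
  induction s using Finset.induction_on with
  | empty => simp
  | insert l s hl ih =>
    rw [Finset.sum_insert hl, Finset.prod_insert hl, ← ih]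
    simp_rw [Finsupp.add_apply, pow_add]
    rw [Finset.prod_mul_distrib]
    congr 1
    rw [Finset.prod_eq_single (v l)]
    · rw [Finsupp.single_eq_same]
    · intro t _ ht; rw [Finsupp.single_eq_of_ne ht, pow_zero]
    · intro h; exact absurd (Finset.mem_univ _) h

/-- The value of `[S_q]` at an LGS coordinate. [cite: KawanoueMatsuki2010, Thm. A.1.1.1 (proof, Step 3, chunk p0059 L36–L41)] -/
theorem lowPart_apply_v (hv : Function.Injective v) (γ : Fin d →₀ ℕ) (l : ι) :
    lowPart p e v E γ (v l) = p ^ e l * lowMulti p e v E γ l := by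
  classical
  rw [lowPart, Finsupp.coe_finsetSum, Finset.sum_apply, Finset.sum_eq_single l]
  · rw [Finsupp.single_eq_same]
  · intro l' _ hl'
    rw [Finsupp.single_eq_of_ne (hv.ne (Ne.symm hl'))]
  · intro hl; exact absurd (Finset.mem_univ l) hl

/-- `[S_q]` vanishes at the coordinates `y` outside the LGS. [cite: KawanoueMatsuki2010, Thm. A.1.1.1 (proof, Step 3, chunk p0059 L36–L41)] -/
theorem lowPart_apply_of_forall_ne (γ : Fin d →₀ ℕ) {t : Fin d} (ht : ∀ l, v l ≠ t) :
    lowPart p e v E γ t = 0 := by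
  classical
  rw [lowPart, Finsupp.coe_finsetSum, Finset.sum_apply]
  exact Finset.sum_eq_zero fun l _ => Finsupp.single_eq_of_ne (ht l).symm

/-- `[S_q] ≤ S`. [cite: KawanoueMatsuki2010, Thm. A.1.1.1 (proof, Step 3, chunk p0059 L36–L41)] -/
theorem lowPart_le (hv : Function.Injective v) (γ : Fin d →₀ ℕ) : lowPart p e v E γ ≤ γ := by
  intro t
  by_cases ht : ∃ l, v l = t
  · obtain ⟨l, rfl⟩ := ht
    rw [lowPart_apply_v p e v E hv, lowMulti_apply]
    split_ifs
    · exact Nat.mul_div_le _ _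
    · simp
  · push Not at ht
    rw [lowPart_apply_of_forall_ne p e v E γ ht]; exact Nat.zero_le _

/-- `|[S_q]| = Σ_l (S_q)_l p^{e_l}`. [cite: KawanoueMatsuki2010, Thm. A.1.1.1 (proof, Step 3, chunk p0059 L36–L41)] -/
theorem degree_lowPart (γ : Fin d →₀ ℕ) : (lowPart p e v E γ).degree = bracketDeg p e (lowMulti p e v E γ) := by
  rw [lowPart, map_sum, bracketDeg]
  exact Finset.sum_congr rfl fun l _ => by rw [Finsupp.degree_single, mul_comm]

/-- `S_q` lives on the indices of level `< e_u`. [cite: KawanoueMatsuki2010, Thm. A.1.1.1 (proof, Step 3, chunk p0059 L36–L41)] -/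
theorem lt_of_mem_support_lowMulti (γ : Fin d →₀ ℕ) : ∀ l ∈ (lowMulti p e v E γ).support, e l < E := by
  intro l hl
  by_contra hE
  exact (Finsupp.mem_support_iff.mp hl) (by simp [hE])

/-- `X^{[S_q]} = ∏_l h_l^{(S_q)_l}` once the lower LGS elements are exact powers `h_l = x_{v l}^{p^{e_l}}`.
[cite: KawanoueMatsuki2010, Thm. A.1.1.1 (proof, Step 3, Subcase 2.2 «X^{S_q} is divisible by …», chunk p0060 L30–L33)] -/
theorem prod_pow_lowPart {R : Type*} [CommRing R] (x : Fin d → R) (h : ι → R)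
    (hlow : ∀ l, e l < E → h l = x (v l) ^ p ^ e l) (γ : Fin d →₀ ℕ) :
    ∏ t, x t ^ (lowPart p e v E γ) t = hPow h (lowMulti p e v E γ) := by
  classical
  rw [lowPart, prod_pow_sum_single, hPow]
  refine Finset.prod_congr rfl fun l _ => ?_
  rw [lowMulti_apply]
  split_ifs with hl
  · rw [pow_mul, hlow l hl]
  · simp

end LowPart

section Operators

variable {k : Type u} [Field k] {R : Type u} [CommRing R] [Algebra k R]
variable {d : ℕ} (x : Fin d → R) (Δ : (Fin d →₀ ℕ) → (R →ₗ[k] R)) {n : ℕ}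
  (hval : ∀ (J β : Fin d →₀ ℕ), J.degree ≤ n →
    Δ J (∏ i, x i ^ β i) = ((∏ i ∈ J.support, (β i).choose (J i) : ℕ) : R) * ∏ i, x i ^ (β - J) i)

/-- The binomial coefficient `(S over J) = ∏_i C(S_i, J_i)` of `∂_J X^S = (S over J) X^{S−J}`.
[cite: KawanoueMatsuki2010, Thm. A.1.1.1 (proof, Step 3, chunks p0059 L54 – p0061 L4)] -/
def binomJ (γ J : Fin d →₀ ℕ) : ℕ := ∏ i ∈ J.support, (γ i).choose (J i)

/-- `(S over J) = 0` unless `J ≤ S`. [cite: KawanoueMatsuki2010, Thm. A.1.1.1 (proof, Step 3, chunks p0059 L54 – p0061 L4)] -/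
theorem binomJ_eq_zero_of_not_le {γ J : Fin d →₀ ℕ} (hJ : ¬ J ≤ γ) : binomJ γ J = 0 := by
  classical
  obtain ⟨i, hi, hlt⟩ : ∃ i ∈ J.support, γ i < J i := by
    by_contra hcon
    push Not at hcon
    exact hJ fun i => by
      by_cases hi : i ∈ J.support
      · exact hcon i hi
      · rw [Finsupp.notMem_support_iff.mp hi]; exact Nat.zero_le _
  exact Finset.prod_eq_zero hi (Nat.choose_eq_zero_of_lt hlt)

/-- `∂_J` applied to a form `F = Σ α_S X^S` with coefficients in `k`: the form `Σ_S α_S (S over J) X^{S − J}`.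
[cite: KawanoueMatsuki2010, Thm. A.1.1.1 (proof, Step 3, chunks p0059 L54 – p0061 L4)] -/
def applyJ (F : MvPolynomial (Fin d) k) (J : Fin d →₀ ℕ) : MvPolynomial (Fin d) k :=
  ∑ γ ∈ F.support, MvPolynomial.monomial (γ - J) (F.coeff γ * (binomJ γ J : ℕ))

/-- `∂_J F` is a form of degree `deg F − |J|`. [cite: KawanoueMatsuki2010, Thm. A.1.1.1 (proof, Step 3, chunks p0059 L54 – p0061 L4)] -/
theorem applyJ_isHomogeneous {F : MvPolynomial (Fin d) k} {l : ℕ} (hF : F.IsHomogeneous l) (J : Fin d →₀ ℕ) :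
    (applyJ F J).IsHomogeneous (l - J.degree) := by
  classical
  refine MvPolynomial.IsHomogeneous.sum _ _ _ fun γ hγ => ?_
  by_cases hJ : J ≤ γ
  · refine MvPolynomial.isHomogeneous_monomial _ ?_
    have hdeg : γ.degree = l := by
      rw [Finsupp.degree_eq_weight_one]; exact hF (MvPolynomial.mem_support_iff.mp hγ)
    have := congrArg Finsupp.degree (tsub_add_cancel_of_le hJ)
    rw [map_add, hdeg] at this
    omega
  · rw [binomJ_eq_zero_of_not_le hJ, Nat.cast_zero, mul_zero, map_zero]
    exact MvPolynomial.isHomogeneous_zero _ _ _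

/-- The coefficient of `X^{S₀ − J}` in `∂_J F` is `α_{S₀} (S₀ over J)` when `J ≤ S₀` (the other exponents `S`
with `S − J = S₀ − J` have `(S over J) = 0`). [cite: KawanoueMatsuki2010, Thm. A.1.1.1 (proof, Step 3, «we conclude
α_{ST} = 0», chunks p0060 L12–L14, p0061 L14–L16)] -/
theorem coeff_applyJ {F : MvPolynomial (Fin d) k} {γ₀ J : Fin d →₀ ℕ} (hJ : J ≤ γ₀) :
    (applyJ F J).coeff (γ₀ - J) = F.coeff γ₀ * (binomJ γ₀ J : ℕ) := by
  classical
  rw [applyJ, MvPolynomial.coeff_sum]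
  simp only [MvPolynomial.coeff_monomial]
  rw [Finset.sum_eq_single γ₀]
  · rw [if_pos rfl]
  · intro γ hγ hne
    by_cases hJγ : J ≤ γ
    · rw [if_neg]
      intro heq
      exact hne (by rw [← tsub_add_cancel_of_le hJγ, heq, tsub_add_cancel_of_le hJ])
    · rw [binomJ_eq_zero_of_not_le hJγ]; simp
  · intro hγ₀
    rw [MvPolynomial.notMem_support_iff.mp hγ₀]; simp

include hval in
/-- `∂_J (1) = 0` for `J ≠ 0`. [cite: KawanoueMatsuki2010, Thm. A.1.1.1 (proof, Step 3 (∗)/(♥): `∂_J (w^{p^{e_u}}) = 0`,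
chunk p0059 L54–L58)] -/
theorem apply_one_eq_zero {J : Fin d →₀ ℕ} (hJ : J ≠ 0) (hJn : J.degree ≤ n) : Δ J 1 = 0 := by
  classical
  have h1 := hval J 0 hJn
  simp only [Finsupp.coe_zero, Pi.zero_apply, pow_zero, Finset.prod_const_one] at h1
  rw [h1]
  obtain ⟨i, hi⟩ : ∃ i, i ∈ J.support := by
    by_contra hcon; push Not at hcon
    exact hJ (Finsupp.support_eq_empty.mp (Finset.eq_empty_of_forall_notMem hcon))
  rw [Finset.prod_eq_zero hi (Nat.choose_eq_zero_of_lt (Nat.pos_of_ne_zero (Finsupp.mem_support_iff.mp hi)))]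
  simp

include hval in
/-- `∂_J (Σ α_S x^S) = Σ α_S (S over J) x^{S−J}` for `α_S ∈ k`. [cite: KawanoueMatsuki2010, Thm. A.1.1.1 (proof,
Step 3, «by applying the differential operator … to (♥)», chunks p0059 L54 – p0060 L7)] -/
theorem apply_aeval (F : MvPolynomial (Fin d) k) {J : Fin d →₀ ℕ} (hJn : J.degree ≤ n) :
    Δ J (MvPolynomial.aeval x F) = MvPolynomial.aeval x (applyJ F J) := by
  classical
  conv_lhs => rw [F.as_sum]
  rw [applyJ, map_sum, map_sum, map_sum]
  refine Finset.sum_congr rfl fun γ _ => ?_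
  rw [MvPolynomial.aeval_monomial, MvPolynomial.aeval_monomial, ← Algebra.smul_def, map_smul, map_mul,
    map_natCast, Finsupp.prod_fintype _ _ fun i => pow_zero _, Finsupp.prod_fintype _ _ fun i => pow_zero _,
    hval J γ hJn, Algebra.smul_def, mul_assoc]
  rfl

end Operators

section KeyStep

variable {k : Type u} [Field k] [PerfectField k] {R : Type u} [CommRing R] [IsRegularLocalRing R] [Algebra k R]
  [Algebra.EssFiniteType k R] [Algebra.FormallySmooth k R]
variable (p : ℕ) [Fact p.Prime] [CharP k p] [CharP R p]
variable {ι : Type*} [Fintype ι] {h : ι → R} {e : ι → ℕ} {𝕀 : IdealisticFiltration R}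
variable {d : ℕ} (hd : (maximalIdeal R).spanFinrank = d) {x : Fin d → R}
  (hx : Ideal.span (Set.range x) = maximalIdeal R) {v : ι → Fin d} (hv : Function.Injective v) {E : ℕ}
  {Δ : (Fin d →₀ ℕ) → (R →ₗ[k] R)}
  (hval : ∀ (J β : Fin d →₀ ℕ), J.degree ≤ p ^ E - 1 →
    Δ J (∏ i, x i ^ β i) = ((∏ i ∈ J.support, (β i).choose (J i) : ℕ) : R) * ∏ i, x i ^ (β - J) i)
  (hdiff : ∀ (dd : ℕ) (J : Fin d →₀ ℕ), J.degree ≤ dd → dd ≤ p ^ E - 1 → IsDiffOpLE k dd (Δ J))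
  (hD : 𝕀.IsDSaturated k) (H : IsWeakLGS p 𝕀 h e) (hμ : muTilde 𝕀 h = ⊤)
  (hh : ∀ l, h l - x (v l) ^ p ^ e l ∈ maximalIdeal R ^ (p ^ e l + 1))

omit [CharP k p] in
include hd hx hval hdiff hD H hμ hh in
/-- **The vanishing of a coefficient** (the common core of Subcases 1.2 and 2.3, chunks p0059 L54 – p0060 L14 and
p0060 L34 – p0061 L16): if `w^q + F(x) ∈ 𝕀_q + 𝔪^{l+1}` ((♥)) for a form `F = Σ α_S x^S` of degree `l` over `k`,
and `J ≤ S₀`, `0 < |J| < q`, `(S₀ over J) ≠ 0` in `k`, and `S₀ − J` is reduced in every LGS coordinate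
(`(S₀ − J)_{v i} < p^{e_i}`), then `α_{S₀} = 0`: apply `∂_J` (which kills `w^q`, Frobenius-linearity), land in
`(𝕀_{q−|J|} + 𝔪^{l−|J|+1}) ∩ 𝔪^{l−|J|} ⊆ Σ_i h_i 𝔪^{l−|J|−p^{e_i}} + 𝔪^{l−|J|+1}` (Step 1 + Part I Lemma 4.1.2.3),
whose initial forms lie in the monomial ideal `(X_{v i}^{p^{e_i}})`; the reduced monomial `X^{S₀−J}` occurs with
coefficient `α_{S₀} (S₀ over J)`. [cite: KawanoueMatsuki2010, Thm. A.1.1.1 (proof, Step 3, Subcases 1.2 and 2.3,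
chunks p0059 L54 – p0060 L14, p0060 L34 – p0061 L16)] -/
theorem coeff_eq_zero_of_forall_lt {l : ℕ} {w : R} {F : MvPolynomial (Fin d) k} (hF : F.IsHomogeneous l)
    (hheart : w ^ p ^ E + MvPolynomial.aeval x F ∈
      𝕀.level ((p ^ E : ℕ) : ℝ) ⊔ maximalIdeal R ^ (l + 1))
    {γ₀ J : Fin d →₀ ℕ} (hJγ : J ≤ γ₀) (hJ0 : J ≠ 0) (hJq : J.degree < p ^ E)
    (hbinom : (binomJ γ₀ J : k) ≠ 0) (hred : ∀ l', (γ₀ - J) (v l') < p ^ e l') : F.coeff γ₀ = 0 := by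
  classical
  by_contra hc0
  have hJn : J.degree ≤ p ^ E - 1 := by omega
  have hdJ : IsDiffOpLE k J.degree (Δ J) := hdiff _ J le_rfl hJn
  -- `∂_J (w^q + F(x)) = (∂_J F)(x)`
  have e1 : Δ J (w ^ p ^ E + MvPolynomial.aeval x F) = MvPolynomial.aeval x (applyJ F J) := by
    rw [map_add, ← mul_one (w ^ p ^ E), IsDiffOpLE.apply_pow_char_pow_mul' p hdJ hJq w 1,
      apply_one_eq_zero x Δ hval hJ0 hJn, mul_zero, zero_add, apply_aeval x Δ hval F hJn]
  -- `∂_J (𝕀_q + 𝔪^{l+1}) ⊆ 𝕀_{q−|J|} + 𝔪^{l+1−|J|}`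
  obtain ⟨a₁, ha₁, b₁, hb₁, hab⟩ := Submodule.mem_sup.mp hheart
  have hmem : MvPolynomial.aeval x (applyJ F J) ∈
      𝕀.level (((p ^ E : ℕ) : ℝ) - (J.degree : ℕ)) ⊔ maximalIdeal R ^ (l + 1 - J.degree) := by
    rw [← e1, ← hab, map_add]
    refine add_mem (Ideal.mem_sup_left ?_) (Ideal.mem_sup_right ?_)
    · exact (IdealisticFiltration.isDSaturated_iff k 𝕀).mp hD _ _ hdJ _ _ ha₁
    · exact hdJ.apply_mem_pow_sub (maximalIdeal R) (l + 1) hb₁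
  have hΨhom := applyJ_isHomogeneous hF J
  have hΨm : MvPolynomial.aeval x (applyJ F J) ∈ maximalIdeal R ^ (l - J.degree) := aeval_mem_pow x hx hΨhom
  obtain ⟨a, ha, b, hb, hab'⟩ := Submodule.mem_sup.mp hmem
  have hJl : J.degree ≤ l := by
    have hdeg : γ₀.degree = l := by
      rw [Finsupp.degree_eq_weight_one]; exact hF hc0
    have := congrArg Finsupp.degree (tsub_add_cancel_of_le hJγ)
    rw [map_add, hdeg] at this; omega
  have ha𝔪 : a ∈ maximalIdeal R ^ (l - J.degree) := by
    have : a = MvPolynomial.aeval x (applyJ F J) - b := by rw [← hab']; ring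
    rw [this]
    exact sub_mem hΨm (Ideal.pow_le_pow_right (by omega) hb)
  have hpos : (0 : ℝ) < ((p ^ E : ℕ) : ℝ) - (J.degree : ℕ) := by
    have : ((J.degree : ℕ) : ℝ) < ((p ^ E : ℕ) : ℝ) := by exact_mod_cast hJq
    linarith
  have haspan : a ∈ Ideal.span (Set.range h) := level_le_span_of_muTilde_eq_top p h e 𝕀 hD H hμ hpos ha
  -- Part I Lemma 4.1.2.3: `a = Σ c_i h_i`, `c_i ∈ 𝔪^{l − |J| − p^{e_i}}`
  obtain ⟨c, hc, hsum⟩ := exists_coeff_mem_pow_of_mem_span_inter_pow p h e H.pow_mem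
    (fun l => (H.pure l).2) H.linearIndependent ha𝔪 haspan
  -- every exponent of `∂_J F` is divisible by some `X_{v i}^{p^{e_i}}` …
  have hb' : MvPolynomial.aeval x (applyJ F J) - ∑ l, c l * h l ∈ maximalIdeal R ^ (l - J.degree + 1) := by
    rw [← hsum]
    have : MvPolynomial.aeval x (applyJ F J) - a = b := by rw [← hab']; ring
    rw [this, show l - J.degree + 1 = l + 1 - J.degree by omega]
    exact hb
  have hdiv := exists_le_of_mem_support hd x hx v (fun l => p ^ e l) h hh hΨhom hc hb'
  -- … but the reduced monomial `X^{S₀ − J}` occurs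
  have hsupp : γ₀ - J ∈ (applyJ F J).support := by
    rw [MvPolynomial.mem_support_iff, coeff_applyJ hJγ]
    exact mul_ne_zero hc0 hbinom
  obtain ⟨l', hl'⟩ := hdiv _ hsupp
  exact absurd (hred l') (not_lt.mpr hl')

include hd hx hv hval hdiff hD H hμ hh in
/-- **The inductive step of claim (◇)**: `(𝕀_P)_{p^{e_u}} ⊆ J_l ⟹ (𝕀_P)_{p^{e_u}} ⊆ J_{l+1}` for `l > p^{e_u}`,
provided the LGS elements of level `< e_u` are exact powers `h_l = x_{v l}^{p^{e_l}}` and every residue class is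
represented in `k ⊂ R` (`k = k̄` in print). For `g = w^q + t + m`, `m ∈ 𝔪^l`, write `m ≡ Σ α_S x^S (mod 𝔪^{l+1})`
with `α_S ∈ k`; then `w^q + Σ α_S x^S ∈ 𝕀_q + 𝔪^{l+1}` ((♥)) and each monomial is treated by the printed case
analysis: Case 2.1 (an LGS coordinate of level `≥ e_u` with exponent `≥ p^{e_i}`): `x^S ∈ h_i 𝔪^{l−p^{e_i}} + 𝔪^{l+1}
⊆ 𝕀_q ∩ 𝔪^{q+1} + 𝔪^{l+1}`; Subcase 2.2 (`|[S_q]| ≥ q`): `x^S ∈ (X^{[S_q]}) ⊆ (X^{[C]})`; Subcase 2.3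
(`0 < |[S_q]| < q`) and Subcase 1.2 (`S_q = 0`, `q ∤ S`): `α_S = 0` by `coeff_eq_zero_of_forall_lt` with
`J = [S_q]` resp. `J = v_{ω,r} ε_ω` (Lucas); Subcase 1.1 (`S_q = 0`, `q ∣ S`): `α_S x^S = (α_S^{1/q} x^{S/q})^q ∈
F^{e_u}(𝔪)`. [cite: KawanoueMatsuki2010, Thm. A.1.1.1 (proof, Step 3, chunks p0059 L19 – p0061 L22)] -/
theorem inJ_step (hk : ∀ r : R, ∃ c : k, r - algebraMap k R c ∈ maximalIdeal R)
    (hlow : ∀ l, e l < E → h l = x (v l) ^ p ^ e l) {l : ℕ} (hl : p ^ E + 1 ≤ l)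
    (IH : ∀ g ∈ 𝕀.level ((p ^ E : ℕ) : ℝ), InJ p h e 𝕀 E l g)
    {g : R} (hg : g ∈ 𝕀.level ((p ^ E : ℕ) : ℝ)) : InJ p h e 𝕀 E (l + 1) g := by
  classical
  have hp : p.Prime := Fact.out
  have hxm : ∀ i, x i ∈ maximalIdeal R := fun i => hx ▸ Ideal.subset_span ⟨i, rfl⟩
  obtain ⟨w, hw, t, ht, hm⟩ := IH g hg
  obtain ⟨F, hF, hFm⟩ := exists_isHomogeneous_aeval_sub_mem x hx hk hm
  -- (♥)
  have hheart : w ^ p ^ E + MvPolynomial.aeval x F ∈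
      𝕀.level ((p ^ E : ℕ) : ℝ) ⊔ maximalIdeal R ^ (l + 1) := by
    have e1 : w ^ p ^ E + MvPolynomial.aeval x F =
        (g - t) - ((g - w ^ p ^ E - t) - MvPolynomial.aeval x F) := by ring
    rw [e1]
    exact sub_mem (Ideal.mem_sup_left (sub_mem hg (tIdeal_le_level H.level_mem ht)))
      (Ideal.mem_sup_right hFm)
  have eg : g = (w ^ p ^ E + t) + ((g - w ^ p ^ E - t) - MvPolynomial.aeval x F) +
      MvPolynomial.aeval x F := by ring
  rw [eg]
  refine InJ.add (InJ.add ⟨w, hw, t, ht, by simp⟩ (InJ.of_mem_pow hFm)) ?_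
  -- the form `F(x) = Σ_S α_S x^S`, monomial by monomial
  have eF : MvPolynomial.aeval x F = ∑ γ ∈ F.support, algebraMap k R (F.coeff γ) * ∏ i, x i ^ γ i := by
    conv_lhs => rw [F.as_sum]
    rw [map_sum]
    exact Finset.sum_congr rfl fun γ _ => by
      rw [MvPolynomial.aeval_monomial, Finsupp.prod_fintype _ _ fun i => pow_zero _]
  rw [eF]
  refine InJ.sum fun γ hγ => ?_
  have hdeg : γ.degree = l := by
    rw [Finsupp.degree_eq_weight_one]; exact hF (MvPolynomial.mem_support_iff.mp hγ)
  have hγle : ∀ t, γ t ≤ l := fun t => by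
    rw [← hdeg, Finsupp.degree_eq_sum]
    exact Finset.single_le_sum (fun i _ => Nat.zero_le _) (Finset.mem_univ t)
  by_cases hc : ∃ l', E ≤ e l' ∧ p ^ e l' ≤ γ (v l')
  · /- Case 2.1: an LGS coordinate of level `≥ e_u` occurs with exponent `≥ p^{e_i}`:
       `x^S = h_i x^{S'} − (h_i − x_{v i}^{p^{e_i}}) x^{S'} ∈ 𝕀_q ∩ 𝔪^{q+1} + 𝔪^{l+1}` -/
    obtain ⟨l', hEl', hγl'⟩ := hc
    have hql' : p ^ E ≤ p ^ e l' := Nat.pow_le_pow_right hp.pos hEl'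
    set γ' := γ - Finsupp.single (v l') (p ^ e l') with hγ'
    have eγ : γ = Finsupp.single (v l') (p ^ e l') + γ' := by
      rw [hγ', add_tsub_cancel_of_le]; exact Finsupp.single_le_iff.mpr hγl'
    have hγ'deg : γ'.degree = l - p ^ e l' := by
      have := congrArg Finsupp.degree eγ
      rw [map_add, Finsupp.degree_single, hdeg] at this; omega
    have exγ : ∏ i, x i ^ γ i = x (v l') ^ p ^ e l' * ∏ i, x i ^ γ' i := by
      conv_lhs => rw [eγ]
      simp_rw [Finsupp.add_apply, pow_add]
      rw [Finset.prod_mul_distrib]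
      congr 1
      rw [Finset.prod_eq_single (v l')]
      · rw [Finsupp.single_eq_same]
      · intro t _ ht; rw [Finsupp.single_eq_of_ne ht, pow_zero]
      · intro h'; exact absurd (Finset.mem_univ _) h'
    have hγ'm : ∏ i, x i ^ γ' i ∈ maximalIdeal R ^ (l - p ^ e l') := by
      have := Hironaka2017.S02Preliminaries.prod_pow_mem_span_pow x γ'
      rwa [hx, hγ'deg] at this
    have hpl : p ^ e l' ≤ l := hγl'.trans (hγle _)
    have e2 : algebraMap k R (F.coeff γ) * ∏ i, x i ^ γ i =
        algebraMap k R (F.coeff γ) * (h l' * ∏ i, x i ^ γ' i) +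
          -(algebraMap k R (F.coeff γ) * ((h l' - x (v l') ^ p ^ e l') * ∏ i, x i ^ γ' i)) := by
      rw [exγ]; ring
    rw [e2]
    refine InJ.add (InJ.of_mem_tIdeal (Ideal.mul_mem_left _ _ (Ideal.mem_sup_right ⟨?_, ?_⟩)))
      (InJ.of_mem_pow (neg_mem (Ideal.mul_mem_left _ _ ?_)))
    · exact Ideal.mul_mem_right _ _ (𝕀.mem_of_le (by exact_mod_cast hql') (H.level_mem l'))
    · have := Ideal.mul_mem_mul (H.pow_mem l') hγ'm
      rw [← pow_add] at this
      exact Ideal.pow_le_pow_right (by omega) this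
    · have := Ideal.mul_mem_mul (hh l') hγ'm
      rw [← pow_add] at this
      exact Ideal.pow_le_pow_right (by omega) this
  · push Not at hc
    -- `hc : ∀ l', E ≤ e l' → γ (v l') < p ^ e l'`
    set C := lowMulti p e v E γ with hC
    set J := lowPart p e v E γ with hJ
    have hJv : ∀ l', J (v l') = p ^ e l' * C l' := fun l' => by rw [hJ, hC, lowPart_apply_v p e v E hv]
    by_cases hC0 : C = 0
    · -- Case 1: `S_q = 0`
      have hlowred : ∀ l', e l' < E → γ (v l') < p ^ e l' := by
        intro l' hEl'
        by_contra hcon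
        have h1 : C l' = 0 := by rw [hC0]; rfl
        rw [hC, lowMulti_apply, if_pos hEl'] at h1
        exact (Nat.div_pos (not_lt.mp hcon) (pow_pos hp.pos _)).ne' h1
      have hred : ∀ l', γ (v l') < p ^ e l' := fun l' => by
        by_cases hEl' : E ≤ e l'
        · exact hc l' hEl'
        · exact hlowred l' (not_le.mp hEl')
      by_cases hdvd : ∀ t, p ^ E ∣ γ t
      · /- Subcase 1.1: `α x^S = (α^{1/q} x^{S/q})^q ∈ F^{e_u}(𝔪)` -/
        set δ : Fin d →₀ ℕ := Finsupp.equivFunOnFinite.symm fun t => γ t / p ^ E with hδ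
        have eγt : ∀ t, γ t = δ t * p ^ E := fun t => by
          rw [hδ, Finsupp.coe_equivFunOnFinite_symm]; exact (Nat.div_mul_cancel (hdvd t)).symm
        have exγ : ∏ i, x i ^ γ i = (∏ i, x i ^ δ i) ^ p ^ E := by
          rw [← Finset.prod_pow]
          exact Finset.prod_congr rfl fun i _ => by rw [← pow_mul, ← eγt i]
        rw [exγ]
        refine InJ.algebraMap_mul_pow _ _ ?_
        obtain ⟨i, hi⟩ : ∃ i, δ i ≠ 0 := by
          by_contra hcon
          push Not at hcon
          have h0 : γ = 0 := by
            ext t; rw [eγt t, hcon t, zero_mul]; rfl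
          rw [h0, map_zero] at hdeg; omega
        obtain ⟨c', hc'⟩ := Finset.dvd_prod_of_mem (fun j => x j ^ δ j) (Finset.mem_univ i)
        rw [hc']
        exact Ideal.mul_mem_right _ _ (Ideal.pow_mem_of_mem _ (hxm i) _ (Nat.pos_of_ne_zero hi))
      · /- Subcase 1.2: `q ∤ S_ω`: `α_S = 0` via `∂_{z_ω^{v_{ω,r}}}` — so `S ∉ supp F`, contradiction -/
        exfalso
        push Not at hdvd
        obtain ⟨ω, hω⟩ := hdvd
        have hr0 : γ ω % p ^ E ≠ 0 := fun h0 => hω (Nat.dvd_of_mod_eq_zero h0)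
        have hrq : γ ω % p ^ E < p ^ E := Nat.mod_lt _ (pow_pos hp.pos E)
        refine MvPolynomial.mem_support_iff.mp hγ (coeff_eq_zero_of_forall_lt p hd hx hval hdiff hD H hμ hh hF
          hheart (J := Finsupp.single ω (γ ω % p ^ E)) (Finsupp.single_le_iff.mpr (Nat.mod_le _ _))
          (by simpa using hr0) (by rwa [Finsupp.degree_single]) ?_ ?_)
        · -- `C(S_ω, v_{ω,r}) ≡ 1 (mod p)` (Lucas)
          rw [binomJ, Finsupp.support_single _ hr0, Finset.prod_singleton, Finsupp.single_eq_same]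
          have h1 := choose_mul_add_self_modEq_one (p := p) E (γ ω / p ^ E) (γ ω % p ^ E) hrq
          rw [Nat.div_add_mod] at h1
          rw [(CharP.natCast_eq_natCast k p).mpr h1, Nat.cast_one]
          exact one_ne_zero
        · intro l'
          rw [Finsupp.tsub_apply]
          exact lt_of_le_of_lt tsub_le_self (hred l')
    · -- Case 2 without high coordinates: `S_q ≠ 0` on the indices of level `< e_u`
      by_cases hbig : p ^ E ≤ bracketDeg p e C
      · /- Subcase 2.2: `x^S = X^{[S_q]} x^{S − [S_q]} ∈ (X^{[C]} ; |[C]| ≥ q)` -/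
        have eγ : ∏ i, x i ^ γ i = hPow h C * ∏ i, x i ^ (γ - J) i := by
          rw [hC, ← prod_pow_lowPart p e v E x h hlow γ, ← Finset.prod_mul_distrib]
          refine Finset.prod_congr rfl fun t _ => ?_
          rw [← pow_add, Finsupp.tsub_apply, hJ, add_tsub_cancel_of_le (lowPart_le p e v E hv γ t)]
        rw [eγ, ← mul_assoc]
        exact InJ.of_mem_tIdeal (Ideal.mul_mem_right _ _ (Ideal.mul_mem_left _ _ (Ideal.mem_sup_left
          (hPow_mem_lowIdeal (lt_of_mem_support_lowMulti p e v E γ) hbig))))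
      · /- Subcase 2.3: `0 < |[S_q]| < q`: `α_S = 0` via `∂_{X^{[S_q]}}` — contradiction -/
        exfalso
        rw [not_le] at hbig
        have hJ0 : J ≠ 0 := by
          intro hJ0
          apply hC0
          ext l'
          have h1 := hJv l'
          rw [hJ0, Finsupp.coe_zero, Pi.zero_apply] at h1
          have := (mul_eq_zero.mp h1.symm).resolve_left (pow_ne_zero _ hp.ne_zero)
          rw [this]; rfl
        refine MvPolynomial.mem_support_iff.mp hγ (coeff_eq_zero_of_forall_lt p hd hx hval hdiff hD H hμ hh hF
          hheart (J := J) (lowPart_le p e v E hv γ) hJ0 (by rw [hJ, degree_lowPart]; exact hbig) ?_ ?_)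
        · -- `(S over [S_q]) = ∏ C(p^{e_i} s_q + s_r, p^{e_i} s_q) ≡ 1 (mod p)` (Lucas)
          rw [binomJ, Nat.cast_prod]
          refine Finset.prod_ne_zero_iff.mpr fun t ht => ?_
          have hfac : (γ t).choose (J t) ≡ 1 [MOD p] := by
            by_cases hvt : ∃ l', v l' = t
            · obtain ⟨l', rfl⟩ := hvt
              rw [hJv l', hC, lowMulti_apply]
              split_ifs with hEl'
              · have h1 := choose_mul_add_mul_modEq_one (p := p) (e l') (γ (v l') / p ^ e l')
                  (γ (v l') % p ^ e l') (Nat.mod_lt _ (pow_pos hp.pos _))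
                rwa [Nat.div_add_mod] at h1
              · simp [Nat.ModEq.refl]
            · push Not at hvt
              exact absurd (by rw [hJ]; exact lowPart_apply_of_forall_ne p e v E γ hvt)
                (Finsupp.mem_support_iff.mp ht)
          rw [(CharP.natCast_eq_natCast k p).mpr hfac, Nat.cast_one]
          exact one_ne_zero
        · intro l'
          rw [Finsupp.tsub_apply]
          by_cases hEl' : E ≤ e l'
          · exact lt_of_le_of_lt tsub_le_self (hc l' hEl')
          · rw [hJv l', hC, lowMulti_apply, if_pos (not_le.mp hEl'), ← Nat.mod_def]
            exact Nat.mod_lt _ (pow_pos hp.pos _)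

end KeyStep

/-! ## §4. Claim (◇) for all `l` and Step 4: `(𝕀_P)_{p^{e_u}} ⊆ F^{e_u}(𝔪_P) + T` by Krull's intersection theorem
over the subring `F^{e_u}(R_P)` -/

section StepFour

variable {k : Type u} [Field k] [PerfectField k] {R : Type u} [CommRing R] [IsRegularLocalRing R] [Algebra k R]
  [Algebra.EssFiniteType k R] [Algebra.FormallySmooth k R]
variable (p : ℕ) [Fact p.Prime] [CharP k p] [CharP R p]
variable {ι : Type*} [Fintype ι] {h : ι → R} {e : ι → ℕ} {𝕀 : IdealisticFiltration R}
variable {d : ℕ} (hd : (maximalIdeal R).spanFinrank = d) {x : Fin d → R}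
  (hx : Ideal.span (Set.range x) = maximalIdeal R) {v : ι → Fin d} (hv : Function.Injective v) {E : ℕ}
  {Δ : (Fin d →₀ ℕ) → (R →ₗ[k] R)}
  (hval : ∀ (J β : Fin d →₀ ℕ), J.degree ≤ p ^ E - 1 →
    Δ J (∏ i, x i ^ β i) = ((∏ i ∈ J.support, (β i).choose (J i) : ℕ) : R) * ∏ i, x i ^ (β - J) i)
  (hdiff : ∀ (dd : ℕ) (J : Fin d →₀ ℕ), J.degree ≤ dd → dd ≤ p ^ E - 1 → IsDiffOpLE k dd (Δ J))
  (hD : 𝕀.IsDSaturated k) (H : IsWeakLGS p 𝕀 h e) (hμ : muTilde 𝕀 h = ⊤)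
  (hh : ∀ l, h l - x (v l) ^ p ^ e l ∈ maximalIdeal R ^ (p ^ e l + 1))

include hd hx hv hval hdiff hD H hμ hh in
/-- **Claim (◇)**: `(𝕀_P)_{p^{e_u}} ⊆ J_l` for every `l` (induction on `l`: `inJ_base`, `inJ_step`).
[cite: KawanoueMatsuki2010, Thm. A.1.1.1 (proof, Step 3, claim (◇), chunks p0059 L5 – p0061 L22)] -/
theorem inJ_all (hk : ∀ r : R, ∃ c : k, r - algebraMap k R c ∈ maximalIdeal R)
    (hlow : ∀ l, e l < E → h l = x (v l) ^ p ^ e l) (l : ℕ) :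
    ∀ g ∈ 𝕀.level ((p ^ E : ℕ) : ℝ), InJ p h e 𝕀 E l g := by
  induction l with
  | zero => intro g hg; exact (inJ_base p h e 𝕀 E x hx v hk hD H hμ hh hg).mono (Nat.zero_le _)
  | succ l ih =>
    intro g hg
    by_cases hl : p ^ E + 1 ≤ l
    · exact inJ_step p hd hx hv hval hdiff hD H hμ hh hk hlow hl ih hg
    · exact (inJ_base p h e 𝕀 E x hx v hk hD H hμ hh hg).mono (by omega)

include hx in
/-- `𝔪_R^{N i} ⊆ 𝔪_S^i R` for `S = F^{E}(R)`, `N = d (p^E − 1) + 1` («`F^{e_u}(𝔪_P^l) R_P ⊃ 𝔪_P^{l'}` for `l' ≫ l`»,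
chunk p0062 L4–L6): a monomial of degree `N` has an exponent `≥ p^E` (pigeonhole), so `𝔪^N ⊆ (x_i^{p^E})_i R ⊆ 𝔪_S R`.
[cite: KawanoueMatsuki2010, Thm. A.1.1.1 (proof, Step 4, chunk p0062 L4–L6); Kunz1969, Thm. 2.1 (proof)] -/
theorem pow_le_map_maximalIdeal_pow (E i : ℕ)
    [IsLocalRing (Hironaka2017.S02Preliminaries.frobeniusPowerSubring R p E)] :
    maximalIdeal R ^ ((d * (p ^ E - 1) + 1) * i) ≤
      (maximalIdeal (Hironaka2017.S02Preliminaries.frobeniusPowerSubring R p E) ^ i).map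
        (algebraMap (Hironaka2017.S02Preliminaries.frobeniusPowerSubring R p E) R) := by
  classical
  set S := Hironaka2017.S02Preliminaries.frobeniusPowerSubring R p E with hS
  rw [pow_mul, Ideal.map_pow]
  refine Ideal.pow_right_mono ?_ i
  -- `𝔪^N ⊆ 𝔪_S R`
  intro m hm
  rw [← hx] at hm
  obtain ⟨F, hF, rfl⟩ := (Ideal.mem_span_pow_iff_exists_isHomogeneous x m).mp hm
  rw [F.as_sum, map_sum]
  refine sum_mem fun γ hγ => ?_
  rw [MvPolynomial.eval_monomial, Finsupp.prod_fintype _ _ fun i => pow_zero _]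
  have hdeg : γ.degree = d * (p ^ E - 1) + 1 :=
    Hironaka2017.S02Preliminaries.degree_eq_of_mem_support_of_isHomogeneous hF hγ
  obtain ⟨i₀, hi₀⟩ := Hironaka2017.S02Preliminaries.exists_le_apply_of_lt_degree (q := p ^ E) (d := d) (γ := γ)
    (by rw [hdeg]; exact Nat.lt_succ_self _)
  have h1 := Hironaka2017.S02Preliminaries.mul_prod_pow_mem_smul_top_of_le (p := p) x hx E hi₀ (F.coeff γ)
  have h2 : (maximalIdeal R).comap S.subtype ≤ maximalIdeal S :=
    IsLocalRing.le_maximalIdeal fun htop => (IsLocalRing.maximalIdeal.isMaximal R).ne_top (by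
      rw [Ideal.eq_top_iff_one] at htop ⊢; exact htop)
  have h3 := Submodule.smul_mono_left (N := (⊤ : Submodule S R)) h2 h1
  rw [Ideal.smul_top_eq_map] at h3
  exact h3

include hd hx hv hval hdiff hD H hμ hh in
/-- **Step 4**: `(𝕀_P)_{p^{e_u}} ⊆ F^{e_u}(𝔪_P) + (X^{[C]}) + (𝕀_P)_{p^{e_u}} ∩ 𝔪_P^{p^{e_u}+1}` (chunk p0061 L24 –
p0062 L9): every `g ∈ 𝕀_q` is `w^q + t` with `w ∈ 𝔪_P` and `t ∈ T`. From (◇) for all `l`, by Krull's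
intersection theorem for the finitely generated module `R_P / K` over the Noetherian local ring `S = F^{e_u}(R_P)`
(`R_P` is a finite `S`-module — F-finiteness, tree `isFFinite_of_essFiniteType`; `K = F^{e_u}(𝔪_P) + T` is an `S`-submodule) and
`𝔪_P^{l'} ⊆ 𝔪_S^l R_P` (`pow_le_map_maximalIdeal_pow`). [cite: KawanoueMatsuki2010, Thm. A.1.1.1 (proof, Step 4,
chunks p0061 L24 – p0062 L9); Matsumura1987, Thm. 8.10] -/
theorem exists_sub_pow_mem_tIdeal (hk : ∀ r : R, ∃ c : k, r - algebraMap k R c ∈ maximalIdeal R)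
    (hlow : ∀ l, e l < E → h l = x (v l) ^ p ^ e l) {g : R} (hg : g ∈ 𝕀.level ((p ^ E : ℕ) : ℝ)) :
    ∃ w ∈ maximalIdeal R, g - w ^ p ^ E ∈ tIdeal p h e 𝕀 E := by
  classical
  have hp : p.Prime := Fact.out
  have hdia := inJ_all p hd hx hv hval hdiff hD H hμ hh hk hlow
  -- the subring `S = F^{E}(R)`, `R` finite over `S`, `S ≃ R` Noetherian local
  set S := Hironaka2017.S02Preliminaries.frobeniusPowerSubring R p E with hS
  haveI : IsDomain R := isDomain_of_isRegularLocalRing R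
  haveI : PerfectRing k p := PerfectField.toPerfectRing p
  haveI : Module.Finite S R := Hironaka2017.S02Preliminaries.moduleFinite_frobeniusPowerSubring_of_isFFinite
    (Hironaka2017.S02Preliminaries.isFFinite_of_essFiniteType (𝕂 := k) p E)
  have hbij : Function.Bijective ((iterateFrobenius R p E).rangeRestrict) :=
    ⟨fun a b hab => iterateFrobenius_inj R p E (congrArg Subtype.val hab), RingHom.rangeRestrict_surjective _⟩
  let eRS : R ≃+* S := RingEquiv.ofBijective _ hbij
  haveI : IsNoetherianRing S := isNoetherianRing_of_ringEquiv R eRS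
  haveI : IsLocalRing S := IsLocalRing.of_surjective' (eRS : R →+* S) eRS.surjective
  -- `K = F(𝔪) + T` as an `S`-submodule of `R`
  set Fm : Submodule S R := Submodule.span S ((fun w : R => w ^ p ^ E) '' (maximalIdeal R : Set R)) with hFm
  set K : Submodule S R := Fm ⊔ (tIdeal p h e 𝕀 E).restrictScalars S with hK
  have hFm_pow : ∀ a ∈ Fm, ∃ w ∈ maximalIdeal R, a = w ^ p ^ E := by
    intro a ha
    induction ha using Submodule.span_induction with
    | mem a ha => obtain ⟨w, hw, rfl⟩ := ha; exact ⟨w, hw, rfl⟩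
    | zero => exact ⟨0, zero_mem _, by rw [zero_pow (pow_ne_zero _ hp.ne_zero)]⟩
    | add a b _ _ iha ihb =>
      obtain ⟨w, hw, rfl⟩ := iha
      obtain ⟨w', hw', rfl⟩ := ihb
      exact ⟨w + w', add_mem hw hw', by rw [add_pow_expChar_pow (p := p) w w' E]⟩
    | smul s a _ iha =>
      obtain ⟨w, hw, rfl⟩ := iha
      obtain ⟨r, hr⟩ := Hironaka2017.S02Preliminaries.mem_frobeniusPowerSubring_iff.mp s.2
      exact ⟨r * w, Ideal.mul_mem_left _ _ hw, by rw [Subring.smul_def, smul_eq_mul, ← hr, mul_pow]⟩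
  -- Krull for `R / K`
  have hKrull : (⨅ i : ℕ, maximalIdeal S ^ i • ⊤ : Submodule S (R ⧸ K)) = ⊥ :=
    Ideal.iInf_pow_smul_eq_bot_of_isLocalRing _ (maximalIdeal.isMaximal S).ne_top
  have hgK : g ∈ K := by
    have hmk : Submodule.Quotient.mk g ∈ (⨅ i : ℕ, maximalIdeal S ^ i • ⊤ : Submodule S (R ⧸ K)) := by
      rw [Submodule.mem_iInf]
      intro i
      obtain ⟨w, hw, t, ht, hm⟩ := hdia ((d * (p ^ E - 1) + 1) * i) g hg
      have e1 : (Submodule.Quotient.mk g : R ⧸ K) = Submodule.Quotient.mk (g - w ^ p ^ E - t) := by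
        rw [eq_comm, Submodule.Quotient.eq]
        have : g - w ^ p ^ E - t - g = -(w ^ p ^ E + t) := by ring
        rw [this]
        exact neg_mem (add_mem (Submodule.mem_sup_left (Submodule.subset_span ⟨w, hw, rfl⟩))
          (Submodule.mem_sup_right ht))
      have hm' : g - w ^ p ^ E - t ∈ (maximalIdeal S ^ i • ⊤ : Submodule S R) := by
        rw [Ideal.smul_top_eq_map]
        exact pow_le_map_maximalIdeal_pow p hx E i hm
      have h2 := Submodule.mem_map_of_mem (f := K.mkQ) hm'
      rw [Submodule.map_smul'', Submodule.map_top, Submodule.range_mkQ] at h2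
      rw [e1]; exact h2
    rw [hKrull, Submodule.mem_bot] at hmk
    exact (Submodule.Quotient.mk_eq_zero K).mp hmk
  obtain ⟨a, ha, t, ht, hat⟩ := Submodule.mem_sup.mp hgK
  obtain ⟨w, hw, rfl⟩ := hFm_pow a ha
  refine ⟨w, hw, ?_⟩
  rw [← hat, add_sub_cancel_left]
  exact ht

end StepFour

/-! ## §5. One level of the induction: the LGS elements of level `e_u` become exact `p^{e_u}`-th powers of new
regular parameters (chunk p0062 L10–L19) -/

section Stage

variable {k : Type u} [Field k] [PerfectField k] {R : Type u} [CommRing R] [IsRegularLocalRing R] [Algebra k R]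
  [Algebra.EssFiniteType k R] [Algebra.FormallySmooth k R]
variable (p : ℕ) [Fact p.Prime] [CharP k p] [CharP R p]
variable {ι : Type*} [Fintype ι] {e : ι → ℕ} {𝕀 : IdealisticFiltration R}
variable {d : ℕ} (hd : (maximalIdeal R).spanFinrank = d) {v : ι → Fin d} (hv : Function.Injective v)

omit [PerfectField k] [Algebra.EssFiniteType k R] [Algebra.FormallySmooth k R] [CharP k p] [CharP R p] in
/-- `T ⊆ Σ_{e_i < e_u} 𝔪^{q − p^{e_i}} h_i + 𝔪^{q+1}`: every `X^{[C]}` with `|[C]| ≥ q` is `h_i · X^{[C] − ε_i}` for an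
index `i` of level `< e_u`. [cite: KawanoueMatsuki2010, Thm. A.1.1.1 (proof, Step 4, «the above inclusion implies …»,
chunk p0062 L10–L16)] -/
theorem tIdeal_le_iSup_sup (h : ι → R) (E : ℕ) (pow_mem : ∀ l, h l ∈ maximalIdeal R ^ p ^ e l) :
    tIdeal p h e 𝕀 E ≤ (⨆ l ∈ Finset.univ.filter (fun l => e l < E),
        maximalIdeal R ^ (p ^ E - p ^ e l) * Ideal.span {h l}) ⊔ maximalIdeal R ^ (p ^ E + 1) := by
  classical
  have hp : p.Prime := Fact.out
  refine sup_le (iSup_le fun B => iSup_le fun hB => iSup_le fun hq => ?_) (inf_le_right.trans le_sup_right)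
  rw [Ideal.span_singleton_le_iff_mem]
  have hB0 : B ≠ 0 := by
    rintro rfl; rw [bracketDeg_zero] at hq; exact absurd hq (not_le.mpr (pow_pos hp.pos E))
  obtain ⟨l₀, hl₀⟩ : ∃ l₀, l₀ ∈ B.support := by
    by_contra hcon; push Not at hcon
    exact hB0 (Finsupp.support_eq_empty.mp (Finset.eq_empty_of_forall_notMem hcon))
  have eB : B = Finsupp.single l₀ 1 + (B - Finsupp.single l₀ 1) := by
    have hBl₀ : 1 ≤ B l₀ := Nat.one_le_iff_ne_zero.mpr (Finsupp.mem_support_iff.mp hl₀)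
    ext l; by_cases hl : l = l₀
    · subst hl; simp; omega
    · simp [Ne.symm hl]
  have hdegB : bracketDeg p e B = p ^ e l₀ + bracketDeg p e (B - Finsupp.single l₀ 1) := by
    conv_lhs => rw [eB]
    rw [bracketDeg_add, bracketDeg_single, one_mul]
  refine Ideal.mem_sup_left (Ideal.mem_iSup_of_mem l₀ (Ideal.mem_iSup_of_mem (by simp [hB l₀ hl₀]) ?_))
  rw [eB, hPow_add, hPow_single, pow_one, mul_comm (h l₀)]
  refine Ideal.mul_mem_mul (Ideal.pow_le_pow_right (by omega) (hPow_mem_pow p h e pow_mem _))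
    (Ideal.mem_span_singleton_self _)

omit [PerfectField k] [IsRegularLocalRing R] [Algebra.EssFiniteType k R] [Algebra.FormallySmooth k R]
  [Fact p.Prime] [CharP k p] [CharP R p] in
/-- Reading off coefficients from membership in `Σ_{e_i < e_u} 𝔪^{q − p^{e_i}} h_i + 𝔪^{q+1}`. [folklore] -/
private theorem exists_coeff_of_mem_iSup_sup [IsLocalRing R] {h : ι → R} {E : ℕ} {t : R}
    (ht : t ∈ (⨆ l ∈ Finset.univ.filter (fun l => e l < E),
        maximalIdeal R ^ (p ^ E - p ^ e l) * Ideal.span {h l}) ⊔ maximalIdeal R ^ (p ^ E + 1)) :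
    ∃ c : ι → R, (∀ l, c l ∈ maximalIdeal R ^ (p ^ E - p ^ e l)) ∧ (∀ l, ¬ e l < E → c l = 0) ∧
      t - ∑ l, c l * h l ∈ maximalIdeal R ^ (p ^ E + 1) := by
  classical
  obtain ⟨y, hy, m, hm, hym⟩ := Submodule.mem_sup.mp ht
  obtain ⟨μ, hμ⟩ := (Submodule.mem_iSup_finset_iff_exists_sum _ y).mp hy
  have hz : ∀ l, ∃ z ∈ maximalIdeal R ^ (p ^ E - p ^ e l), z * h l = (μ l : R) := fun l =>
    Ideal.mem_mul_span_singleton.mp (μ l).2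
  choose z hz hzμ using hz
  refine ⟨fun l => if e l < E then z l else 0, fun l => ?_, fun l hl => if_neg hl, ?_⟩
  · show (if e l < E then z l else 0) ∈ _
    split_ifs
    · exact hz l
    · exact zero_mem _
  · have e1 : ∑ l, (if e l < E then z l else 0) * h l = y := by
      rw [← hμ, ← Finset.sum_filter_add_sum_filter_not Finset.univ (fun l => e l < E)]
      rw [Finset.sum_eq_zero (s := Finset.univ.filter fun l => ¬ e l < E) fun l hl => by
        rw [if_neg (Finset.mem_filter.mp hl).2, zero_mul], add_zero]
      exact Finset.sum_congr rfl fun l hl => by rw [if_pos (Finset.mem_filter.mp hl).2, hzμ]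
    rw [e1, ← hym, add_sub_cancel_left]
    exact hm

omit [PerfectField k] [Algebra.EssFiniteType k R] [Algebra.FormallySmooth k R] in
include hd hv in
/-- **The leading form of `w`** when `h_l = w^{q} + t`, `t ∈ T`, `e_l = e_u` («form a `k`-basis of `L(𝕀_P)_{p^{e_u}}`»,
chunk p0062 L12–L16): writing `w ≡ Σ_t a_t x_t (mod 𝔪²)` with `a_t ∈ k`, one has `a_{v l} = 1` and `a_t = 0`
unless `t = v l` or `t = v i` with `e_i < e_u`. Indeed `(Σ a_t x_t)^q − x_{v l}^q ≡ −Σ_{e_i<e_u} c_i h_i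
(mod 𝔪^{q+1})`, so (`exists_le_of_mem_support` for the lower family) every monomial `X_t^q` with nonzero coefficient
in `Σ a_t^q X_t^q − X_{v l}^q` is divisible by some `X_{v i}^{p^{e_i}}`, `e_i < e_u`.
[cite: KawanoueMatsuki2010, Thm. A.1.1.1 (proof, Step 4, chunk p0062 L10–L19)] -/
theorem exists_leading_coeffs (hk : ∀ r : R, ∃ c : k, r - algebraMap k R c ∈ maximalIdeal R)
    {x : Fin d → R} (hx : Ideal.span (Set.range x) = maximalIdeal R) {h : ι → R}
    (pow_mem : ∀ l, h l ∈ maximalIdeal R ^ p ^ e l) {E : ℕ}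
    (hh : ∀ l, h l - x (v l) ^ p ^ e l ∈ maximalIdeal R ^ (p ^ e l + 1)) {l : ι} (hl : e l = E) {w : R}
    (hw : w ∈ maximalIdeal R) (hwT : h l - w ^ p ^ E ∈ tIdeal p h e 𝕀 E) :
    ∃ a : Fin d → k, w - ∑ t, algebraMap k R (a t) * x t ∈ maximalIdeal R ^ 2 ∧ a (v l) = 1 ∧
      ∀ t, t ≠ v l → (∀ l', e l' < E → v l' ≠ t) → a t = 0 := by
  classical
  have hp : p.Prime := Fact.out
  have hq1 : 1 ≤ p ^ E := Nat.one_le_pow _ _ hp.pos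
  have hxm : ∀ i, x i ∈ maximalIdeal R := fun i => hx ▸ Ideal.subset_span ⟨i, rfl⟩
  -- `w ≡ Σ a_t x_t (mod 𝔪²)`
  obtain ⟨r, hr⟩ := Ideal.mem_span_range_iff_exists_fun.mp (hx ▸ hw : w ∈ Ideal.span (Set.range x))
  choose a ha using fun t => hk (r t)
  have hwa : w - ∑ t, algebraMap k R (a t) * x t ∈ maximalIdeal R ^ 2 := by
    rw [← hr, ← Finset.sum_sub_distrib, pow_two]
    exact sum_mem fun t _ => by rw [← sub_mul]; exact Ideal.mul_mem_mul (ha t) (hxm t)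
  refine ⟨a, hwa, ?_⟩
  -- `h_l − w^q ≡ Σ_{lower} c_i h_i (mod 𝔪^{q+1})`
  obtain ⟨c, hc, hc0, hrest⟩ := exists_coeff_of_mem_iSup_sup p (tIdeal_le_iSup_sup p h E pow_mem hwT)
  -- the form `Φ = Σ_t a_t^q X_t^q − X_{v l}^q`
  set Φ : MvPolynomial (Fin d) k := ∑ t, MvPolynomial.monomial (Finsupp.single t (p ^ E)) (a t ^ p ^ E) -
    MvPolynomial.monomial (Finsupp.single (v l) (p ^ E)) 1 with hΦ
  have hΦhom : Φ.IsHomogeneous (p ^ E) := by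
    refine (MvPolynomial.IsHomogeneous.sum _ _ _ fun t _ => ?_).sub ?_ <;>
      exact MvPolynomial.isHomogeneous_monomial _ (by rw [Finsupp.degree_single])
  have hΦeval : MvPolynomial.aeval x Φ = (∑ t, algebraMap k R (a t) * x t) ^ p ^ E - x (v l) ^ p ^ E := by
    rw [hΦ, map_sub, map_sum, sum_pow_char_pow]
    congr 1
    · refine Finset.sum_congr rfl fun t _ => ?_
      simp only [MvPolynomial.aeval_monomial, map_pow, mul_pow, Finsupp.prod_single_index, pow_zero]
    · simp only [MvPolynomial.aeval_monomial, map_one, one_mul, Finsupp.prod_single_index, pow_zero]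
  have hcoeff : ∀ t, Φ.coeff (Finsupp.single t (p ^ E)) = a t ^ p ^ E - if t = v l then 1 else 0 := by
    intro t
    rw [hΦ, MvPolynomial.coeff_sub, MvPolynomial.coeff_sum, MvPolynomial.coeff_monomial,
      Finset.sum_eq_single t]
    · rw [MvPolynomial.coeff_monomial, if_pos rfl]
      congr 1
      by_cases htl : t = v l
      · rw [if_pos htl, if_pos (by rw [htl])]
      · rw [if_neg htl, if_neg (fun h' => htl ((Finsupp.single_left_inj (by positivity)).mp h').symm)]
    · intro s _ hst
      rw [MvPolynomial.coeff_monomial, if_neg (fun h' => hst ((Finsupp.single_left_inj (by positivity)).mp h'))]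
    · intro h'; exact absurd (Finset.mem_univ t) h'
  -- `Φ(x) ≡ −Σ_{lower} c_i h_i (mod 𝔪^{q+1})`, for the lower subfamily
  have hmem : MvPolynomial.aeval x Φ - ∑ l' : {l' // e l' < E}, (-c l'.1) * h l'.1 ∈
      maximalIdeal R ^ (p ^ E + 1) := by
    have e1 : ∑ l' : {l' // e l' < E}, (-c l'.1) * h l'.1 = -∑ l', c l' * h l' := by
      rw [← Finset.sum_subtype (Finset.univ.filter fun l' => e l' < E) (fun _ => by simp)
        (fun l' => (-c l') * h l')]
      rw [← Finset.sum_filter_add_sum_filter_not Finset.univ (fun l' => e l' < E) (fun l' => c l' * h l')]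
      rw [Finset.sum_eq_zero (s := Finset.univ.filter fun l' => ¬ e l' < E) fun l' hl' => by
        rw [hc0 l' (Finset.mem_filter.mp hl').2, zero_mul], add_zero, ← Finset.sum_neg_distrib]
      exact Finset.sum_congr rfl fun l' _ => by ring
    have e2 : MvPolynomial.aeval x Φ - ∑ l' : {l' // e l' < E}, (-c l'.1) * h l'.1 =
        (∑ t, algebraMap k R (a t) * x t - w) ^ p ^ E - ((h l - w ^ p ^ E) - ∑ l', c l' * h l') +
          (h l - x (v l) ^ p ^ e l) := by
      rw [e1, hΦeval, sub_pow_expChar_pow (p := p), hl]; ring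
    rw [e2]
    refine add_mem (sub_mem ?_ hrest) (by rw [← hl]; exact hh l)
    have h2 : (∑ t, algebraMap k R (a t) * x t - w) ∈ maximalIdeal R ^ 2 := by
      rw [← neg_sub]; exact neg_mem hwa
    have := Ideal.pow_mem_pow h2 (p ^ E)
    rw [← pow_mul] at this
    exact Ideal.pow_le_pow_right (by omega) this
  have hdiv := exists_le_of_mem_support hd x hx (fun l' : {l' // e l' < E} => v l'.1) (fun l' => p ^ e l'.1)
    (fun l' => h l'.1) (fun l' => hh l'.1) hΦhom (c := fun l' => -c l'.1) (fun l' => neg_mem (hc l'.1)) hmem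
  -- read off the coefficients
  have hvanish : ∀ t, (∀ l', e l' < E → v l' ≠ t) → Φ.coeff (Finsupp.single t (p ^ E)) = 0 := by
    intro t ht
    by_contra hne
    obtain ⟨l', hl'⟩ := hdiv _ (MvPolynomial.mem_support_iff.mpr hne)
    rw [Finsupp.single_apply, if_neg (ht l'.1 l'.2).symm] at hl'
    exact absurd hl' (not_le.mpr (pow_pos hp.pos _))
  have hlE : ∀ l', e l' < E → v l' ≠ v l := fun l' hl' heq => by
    have := hv heq; subst this; omega
  refine ⟨?_, fun t htl ht => ?_⟩
  · have h1 := hvanish (v l) hlE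
    rw [hcoeff, if_pos rfl, sub_eq_zero] at h1
    have h2 : (a (v l) - 1) ^ p ^ E = 0 := by rw [sub_pow_expChar_pow (p := p), h1, one_pow, sub_self]
    exact sub_eq_zero.mp (pow_eq_zero_iff (by positivity) |>.mp h2)
  · have h1 := hvanish t ht
    rw [hcoeff, if_neg htl, sub_zero] at h1
    exact pow_eq_zero_iff (by positivity) |>.mp h1

include hd hv in
/-- **One level of the induction** (Step 4, «by replacing the original `h_{u_j}` … by `h'_{u_j}` and then by
considering the next level inductively», chunk p0062 L12–L19): given a regular system of parameters adapted to an LGS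
`ℍ` of invariant `μ = ∞` whose elements of level `< e_u` are exact powers `x_{v l}^{p^{e_l}}`, there are new regular
parameters `x'` (changed only at the coordinates of level `e_u`, and only modulo `𝔪²`) and a new LGS `ℍ'` of `𝕀_P` (same
levels, same leading terms, `μ = ∞` by Prop. 3.1.2.1) whose elements of level `≤ e_u` are exact powers
`x'_{v l}^{p^{e_l}} ∈ F^{e_l}(𝔪_P) ∩ (𝕀_P)_{p^{e_l}}`. [cite: KawanoueMatsuki2010, Thm. A.1.1.1 (proof, Step 4, chunk
p0062 L10–L19)] -/
theorem exists_next_level (hk : ∀ r : R, ∃ c : k, r - algebraMap k R c ∈ maximalIdeal R)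
    (hD : 𝕀.IsDSaturated k) (E : ℕ) {x : Fin d → R} (hx : Ideal.span (Set.range x) = maximalIdeal R)
    {h : ι → R} (H : IsLGS p 𝕀 h e) (hμ : muTilde 𝕀 h = ⊤)
    (hh : ∀ l, h l - x (v l) ^ p ^ e l ∈ maximalIdeal R ^ (p ^ e l + 1))
    (hlow : ∀ l, e l < E → h l = x (v l) ^ p ^ e l) :
    ∃ (x' : Fin d → R) (h' : ι → R), Ideal.span (Set.range x') = maximalIdeal R ∧ IsLGS p 𝕀 h' e ∧
      muTilde 𝕀 h' = ⊤ ∧ (∀ l, h' l - x' (v l) ^ p ^ e l ∈ maximalIdeal R ^ (p ^ e l + 1)) ∧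
      (∀ l, e l < E + 1 → h' l = x' (v l) ^ p ^ e l) := by
  classical
  have hp : p.Prime := Fact.out
  have hq1 : 1 ≤ p ^ E := Nat.one_le_pow _ _ hp.pos
  have hxm : ∀ i, x i ∈ maximalIdeal R := fun i => hx ▸ Ideal.subset_span ⟨i, rfl⟩
  -- a truncated Hasse–Schmidt system along `x`, of level `p^E − 1`
  obtain ⟨Δ, -, -, hval, hdiff⟩ := exists_hasseSystem_of_span_eq_maximalIdeal (k := k) x hx
    (by rw [Fintype.card_fin, hd]) (p ^ E - 1)
  -- Step 4 for every index of level `E`: `h_l = w_l^q + t_l`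
  have key : ∀ l, ∃ w ∈ maximalIdeal R, e l = E → h l - w ^ p ^ E ∈ tIdeal p h e 𝕀 E := by
    intro l
    by_cases hl : e l = E
    · have hg : h l ∈ 𝕀.level ((p ^ E : ℕ) : ℝ) := hl ▸ H.level_mem l
      obtain ⟨w, hw, hwT⟩ := exists_sub_pow_mem_tIdeal p hd hx hv hval hdiff hD H.isWeakLGS hμ hh hk hlow hg
      exact ⟨w, hw, fun _ => hwT⟩
    · exact ⟨0, zero_mem _, fun h' => absurd h' hl⟩
  choose w hw hwT using key
  -- leading coefficients of the `w_l`
  have key2 : ∀ l, ∃ a : Fin d → k, e l = E →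
      (w l - ∑ t, algebraMap k R (a t) * x t ∈ maximalIdeal R ^ 2 ∧ a (v l) = 1 ∧
        ∀ t, t ≠ v l → (∀ l', e l' < E → v l' ≠ t) → a t = 0) := by
    intro l
    by_cases hl : e l = E
    · obtain ⟨a, ha⟩ := exists_leading_coeffs p hd hv hk hx H.pow_mem hh hl (hw l) (hwT l hl)
      exact ⟨a, fun _ => ha⟩
    · exact ⟨0, fun h' => absurd h' hl⟩
  choose a ha using key2
  -- the new coordinates `z_l = w_l − Σ_{e_i < E} a_{v i} x_{v i}` of level `E`
  set low : Finset ι := Finset.univ.filter (fun l' => e l' < E) with hlowdef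
  set z : ι → R := fun l => w l - ∑ l' ∈ low, algebraMap k R (a l (v l')) * x (v l') with hz
  have hzx : ∀ l, e l = E → z l - x (v l) ∈ maximalIdeal R ^ 2 := by
    intro l hl
    obtain ⟨h1, h2, h3⟩ := ha l hl
    -- `Σ_t a_t x_t = x_{v l} + Σ_{lower} a_{v i} x_{v i}`
    have hsum : ∑ t, algebraMap k R (a l t) * x t =
        x (v l) + ∑ l' ∈ low, algebraMap k R (a l (v l')) * x (v l') := by
      have hvl : v l ∉ low.image v := by
        rw [Finset.mem_image]
        rintro ⟨l', hl', hvl'⟩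
        have := hv hvl'; subst this
        exact absurd hl ((Finset.mem_filter.mp hl').2.ne)
      rw [← Finset.sum_subset (Finset.subset_univ (insert (v l) (low.image v))) (fun t _ ht => by
        rw [Finset.mem_insert, not_or, Finset.mem_image] at ht
        rw [h3 t ht.1 (fun l' hl' hvt => ht.2 ⟨l', Finset.mem_filter.mpr ⟨Finset.mem_univ _, hl'⟩, hvt⟩),
          map_zero, zero_mul])]
      rw [Finset.sum_insert hvl, h2, map_one, one_mul, Finset.sum_image fun l₁ _ l₂ _ h => hv h]
    have e1 : z l - x (v l) = w l - ∑ t, algebraMap k R (a l t) * x t := by rw [hz, hsum]; ring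
    rw [e1]; exact h1
  -- the new regular system of parameters
  set x' : Fin d → R := fun t => if ht : ∃ l, e l = E ∧ v l = t then z (Classical.choose ht) else x t with hx'
  have hx'v : ∀ l, e l = E → x' (v l) = z l := by
    intro l hl
    have ht : ∃ l₀, e l₀ = E ∧ v l₀ = v l := ⟨l, hl, rfl⟩
    rw [hx']; dsimp only; rw [dif_pos ht, hv (Classical.choose_spec ht).2]
  have hx't : ∀ t, (¬ ∃ l, e l = E ∧ v l = t) → x' t = x t := fun t ht => by
    rw [hx']; dsimp only; rw [dif_neg ht]
  have hx'ne : ∀ l, e l ≠ E → x' (v l) = x (v l) := fun l hl =>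
    hx't _ fun ⟨l₀, hl₀, hv₀⟩ => hl (hv hv₀ ▸ hl₀)
  have hsub2 : ∀ t, x' t - x t ∈ maximalIdeal R ^ 2 := by
    intro t
    by_cases ht : ∃ l, e l = E ∧ v l = t
    · obtain ⟨l, hl, rfl⟩ := ht
      rw [hx'v l hl]; exact hzx l hl
    · rw [hx't t ht, sub_self]; exact zero_mem _
  have hx'span : Ideal.span (Set.range x') = maximalIdeal R := span_eq_maximalIdeal_of_sub_mem_sq hx hsub2
  -- `z_l^q ∈ 𝕀_q`
  have hzq : ∀ l, e l = E → z l ^ p ^ E ∈ 𝕀.level ((p ^ e l : ℕ) : ℝ) := by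
    intro l hl
    rw [hl]
    have e1 : z l ^ p ^ E = (h l - (h l - w l ^ p ^ E)) -
        ∑ l' ∈ low, algebraMap k R (a l (v l')) ^ p ^ E * x (v l') ^ p ^ E := by
      rw [hz, sub_pow_expChar_pow (p := p), sum_pow_char_pow]
      simp_rw [mul_pow]; ring
    rw [e1]
    refine sub_mem (sub_mem (hl ▸ H.level_mem l) (tIdeal_le_level H.level_mem (hwT l hl)))
      (sum_mem fun l' hl' => Ideal.mul_mem_left _ _ ?_)
    have hlt : e l' < E := (Finset.mem_filter.mp hl').2
    -- `x_{v i}^q = h_i^{p^{E − e_i}} ∈ 𝕀_q`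
    have e2 : x (v l') ^ p ^ E = hPow h (Finsupp.single l' (p ^ (E - e l'))) := by
      rw [hPow_single, hlow l' hlt, ← pow_mul, ← pow_add, Nat.add_sub_cancel' hlt.le]
    rw [e2]
    have := hPow_mem_level p h e 𝕀 H.level_mem (Finsupp.single l' (p ^ (E - e l')))
    rwa [bracketDeg_single, ← pow_add, Nat.sub_add_cancel hlt.le] at this
  -- the new LGS
  set h' : ι → R := fun l => if e l = E then x' (v l) ^ p ^ E else h l with hh'def
  have hlev' : ∀ l, h' l ∈ 𝕀.level ((p ^ e l : ℕ) : ℝ) := by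
    intro l
    by_cases hl : e l = E
    · rw [hh'def]; simp only [hl, if_true]; rw [hx'v l hl]; exact hl ▸ hzq l hl
    · rw [hh'def]; simp only [hl, if_false]; exact H.level_mem l
  have hsub' : ∀ l, h' l - h l ∈ maximalIdeal R ^ (p ^ e l + 1) := by
    intro l
    by_cases hl : e l = E
    · rw [hh'def]; simp only [hl, if_true]; rw [hx'v l hl]
      have e1 : z l ^ p ^ E - h l = (z l - x (v l)) ^ p ^ E - (h l - x (v l) ^ p ^ e l) := by
        conv_rhs => rw [sub_pow_expChar_pow (p := p)]
        rw [hl]; ring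
      rw [e1, ← hl]
      refine sub_mem ?_ (hh l)
      have := Ideal.pow_mem_pow (hzx l hl) (p ^ e l)
      rw [← pow_mul] at this
      exact Ideal.pow_le_pow_right (by rw [hl]; omega) this
    · rw [hh'def]; simp only [hl, if_false, sub_self]; exact zero_mem _
  have H' : IsLGS p 𝕀 h' e := isLGS_congr p H hlev' hsub'
  refine ⟨x', h', hx'span, H', ?_, fun l => ?_, fun l hl => ?_⟩
  · rw [← muTilde_eq_of_isLGS (k := k) p 𝕀 hD H H']; exact hμ
  · by_cases hl : e l = E
    · rw [hh'def]; simp only [hl, if_true, sub_self]; exact zero_mem _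
    · rw [hh'def]; simp only [hl, if_false]; rw [hx'ne l hl]; exact hh l
  · by_cases hl' : e l = E
    · rw [hh'def]; simp only [hl', if_true]
    · have hlt : e l < E := by omega
      rw [hh'def]; simp only [hl', if_false]; rw [hx'ne l hl']; exact hlow l hlt

end Stage

/-! ## §6. The induction over the levels `e_1 < ⋯ < e_M` (Steps 2–4 assembled) and the characteristic-zero case -/

section Levels

variable {k : Type u} [Field k] [PerfectField k] {R : Type u} [CommRing R] [IsRegularLocalRing R] [Algebra k R]
  [Algebra.EssFiniteType k R] [Algebra.FormallySmooth k R]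
variable (p : ℕ) {ι : Type*} [Fintype ι] {e : ι → ℕ} (𝕀 : IdealisticFiltration R)

/-- **Steps 2–4 of the proof of Thm. A.1.1.1 (1), prime characteristic**: an LGS `ℍ` of a 𝔇-saturated `𝕀_P`
with `μ = ∞` can be replaced by one consisting of exact powers `x_{v l}^{p^{e_l}}` of (part of) a regular system of
parameters, with the same levels (induction on the level, `exists_next_level`, starting from regular parameters adapted
to `ℍ`, Part I Rem. 4.1.1.1 (3)). [cite: KawanoueMatsuki2010, Thm. A.1.1.1 (proof, Steps 2–4, chunks p0058 L10 –
p0062 L19)] -/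
theorem exists_rsop_isLGS_pow [Fact p.Prime] [CharP k p] [CharP R p]
    (hk : ∀ r : R, ∃ c : k, r - algebraMap k R c ∈ maximalIdeal R) (hD : 𝕀.IsDSaturated k)
    {h : ι → R} (H : IsLGS p 𝕀 h e) (hμ : muTilde 𝕀 h = ⊤) :
    ∃ (d : ℕ) (x : Fin d → R) (v : ι → Fin d), (maximalIdeal R).spanFinrank = d ∧
      Ideal.span (Set.range x) = maximalIdeal R ∧ Function.Injective v ∧
      IsLGS p 𝕀 (fun l => x (v l) ^ p ^ e l) e ∧ muTilde 𝕀 (fun l => x (v l) ^ p ^ e l) = ⊤ := by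
  classical
  obtain ⟨d, x, v, hd, hx, hv, hh⟩ :=
    exists_rsop_sub_pow_mem p h e H.pow_mem (fun l => (H.pure l).2) H.linearIndependent
  have main : ∀ E : ℕ, ∃ (x' : Fin d → R) (h' : ι → R), Ideal.span (Set.range x') = maximalIdeal R ∧
      IsLGS p 𝕀 h' e ∧ muTilde 𝕀 h' = ⊤ ∧ (∀ l, h' l - x' (v l) ^ p ^ e l ∈ maximalIdeal R ^ (p ^ e l + 1)) ∧
      (∀ l, e l < E → h' l = x' (v l) ^ p ^ e l) := by
    intro E
    induction E with
    | zero => exact ⟨x, h, hx, H, hμ, hh, fun l hl => absurd hl (Nat.not_lt_zero _)⟩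
    | succ E ih =>
      obtain ⟨x', h', hx', H', hμ', hh', hlow'⟩ := ih
      exact exists_next_level p hd hv hk hD E hx' H' hμ' hh' hlow'
  obtain ⟨x', h', hx', H', hμ', -, hlow'⟩ := main (Finset.univ.sup e + 1)
  have heq : h' = fun l => x' (v l) ^ p ^ e l :=
    funext fun l => hlow' l (Nat.lt_succ_of_le (Finset.le_sup (Finset.mem_univ l)))
  subst heq
  exact ⟨d, x', v, hd, hx', hv, H', hμ'⟩

/-- **The characteristic-zero case** (`p = 1`, the tree's convention `p = ∞`: all levels `p^{e_l} = 1`): the elements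
of an LGS are themselves part of a regular system of parameters (`h_l ≡ x_{v l} (mod 𝔪²)`, Nakayama).
[cite: KawanoueMatsuki2010, Thm. A.1.1.1 (1) and Part I Def. 3.1.3.1 (the case `char k = 0`)] -/
theorem exists_rsop_isLGS_pow_one [ExpChar R 1] {h : ι → R} (H : IsLGS 1 𝕀 h e)
    (hμ : muTilde 𝕀 h = ⊤) :
    ∃ (d : ℕ) (x : Fin d → R) (v : ι → Fin d), (maximalIdeal R).spanFinrank = d ∧
      Ideal.span (Set.range x) = maximalIdeal R ∧ Function.Injective v ∧
      IsLGS 1 𝕀 (fun l => x (v l) ^ 1 ^ e l) e ∧ muTilde 𝕀 (fun l => x (v l) ^ 1 ^ e l) = ⊤ := by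
  classical
  obtain ⟨d, x, v, hd, hx, hv, hh⟩ :=
    exists_rsop_sub_pow_mem 1 h e H.pow_mem (fun l => (H.pure l).2) H.linearIndependent
  set x' : Fin d → R := fun t => if ht : ∃ l, v l = t then h (Classical.choose ht) else x t with hx'
  have hx'v : ∀ l, x' (v l) = h l := fun l => by
    have ht : ∃ l₀, v l₀ = v l := ⟨l, rfl⟩
    rw [hx']; dsimp only; rw [dif_pos ht, hv (Classical.choose_spec ht)]
  have hsub : ∀ t, x' t - x t ∈ maximalIdeal R ^ 2 := by
    intro t
    by_cases ht : ∃ l, v l = t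
    · obtain ⟨l, rfl⟩ := ht
      rw [hx'v]
      have := hh l
      simpa using this
    · rw [hx']; dsimp only; rw [dif_neg ht, sub_self]; exact zero_mem _
  have heq : (fun l => x' (v l) ^ 1 ^ e l) = h := funext fun l => by rw [one_pow, pow_one, hx'v]
  refine ⟨d, x', v, hd, span_eq_maximalIdeal_of_sub_mem_sq hx hsub, hv, ?_, ?_⟩
  · rw [heq]; exact H
  · rw [heq]; exact hμ

omit [Fintype ι] in
/-- Reindexing a leading generator system along a bijection of the index set. [cite: Kawanoue2007, Def. 3.1.3.1] -/
theorem isLGS_comp_equiv {ι' : Type*} {h : ι → R} (H : IsLGS p 𝕀 h e) (τ : ι' ≃ ι) :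
    IsLGS p 𝕀 (h ∘ τ) (e ∘ τ) := by
  have hpm : ∀ i, (h ∘ τ) i ∈ maximalIdeal R ^ p ^ (e ∘ τ) i := fun i => H.pow_mem (τ i)
  -- the family at level `e₀` is the old one composed with the induced bijection of index subtypes
  have hfam : ∀ e₀, lgsFamily p (h ∘ τ) (e ∘ τ) hpm e₀ =
      lgsFamily p h e H.pow_mem e₀ ∘ (τ.subtypeEquiv (p := fun i' => (e ∘ τ) i' ≤ e₀)
        (q := fun i => e i ≤ e₀) fun _ => Iff.rfl) := fun e₀ => by
    funext i; rfl
  refine ⟨fun i => H.level_mem (τ i), hpm, fun i => H.pure (τ i), fun e₀ => ?_, fun e₀ => ?_, fun e₀ => ?_⟩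
  · rw [hfam]; exact (H.injective e₀).comp (Equiv.injective _)
  · rw [hfam]; exact (H.linearIndependent e₀).comp _ (Equiv.injective _)
  · rw [hfam, EquivLike.range_comp]; exact H.span_eq e₀

end Levels

/-! ## §7. Theorem A.1.1.1 (1) in the printed setting `R_P = A_𝔫` -/

section AtPrime

/-- Over `R = A_𝔫` (`A` of finite type over `k = k̄`, `𝔫` maximal) every residue class has a representative in `k`:
the residue field `A/𝔫` is `k` (Nullstellensatz). [folklore] -/
private theorem exists_sub_algebraMap_mem (k : Type u) [Field k] [IsAlgClosed k]
    (A : Type u) [CommRing A] [Algebra k A] [Algebra.FiniteType k A] (𝔫 : Ideal A) [𝔫.IsMaximal]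
    (r : Localization.AtPrime 𝔫) :
    ∃ c : k, r - algebraMap k (Localization.AtPrime 𝔫) c ∈ maximalIdeal (Localization.AtPrime 𝔫) := by
  letI : Field (A ⧸ 𝔫) := Ideal.Quotient.field 𝔫
  haveI : Module.Finite k (A ⧸ 𝔫) := finite_of_finite_type_of_isJacobsonRing k (A ⧸ 𝔫)
  haveI : Algebra.IsIntegral k (A ⧸ 𝔫) := Algebra.IsIntegral.of_finite k _
  have hbij := IsAlgClosed.algebraMap_bijective_of_isIntegral (k := k) (K := A ⧸ 𝔫)
  set ε := IsLocalization.AtPrime.equivQuotMaximalIdeal 𝔫 (Localization.AtPrime 𝔫) with hε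
  obtain ⟨c, hc⟩ := hbij.2 (ε.symm (Ideal.Quotient.mk _ r))
  refine ⟨c, ?_⟩
  rw [← Ideal.Quotient.eq]
  have h1 : ε (algebraMap k (A ⧸ 𝔫) c) = Ideal.Quotient.mk _ r := by rw [hc, RingEquiv.apply_symm_apply]
  rw [← h1, IsScalarTower.algebraMap_apply k A (A ⧸ 𝔫) c, Ideal.Quotient.algebraMap_eq, hε,
    IsLocalization.AtPrime.equivQuotMaximalIdeal_apply_mk, ← IsScalarTower.algebraMap_apply]

/-- **Kawanoue–Matsuki 2010, Theorem A.1.1.1 (1)** [chunk p0056 L11–L17: «Let `P ∈ Supp(𝕀) ⊂ W` be a closed point.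
Then there exist a regular system of parameters `(x_1, …, x_d)` at `P`, a nonnegative integer `N ≤ d` and a set of
nonnegative integers `{e_1, …, e_N}` with `e_1 ≤ ⋯ ≤ e_N` such that `ℍ = {(x_l^{p^{e_l}}, p^{e_l})}_{l=1}^N` is an
LGS of `𝕀_P` and `𝕀_P = G_{R_P}(ℍ)`.»], proved along the printed Steps 1–4 (A.1.2, chunks p0057 L15 – p0062 L19):
Step 1 `𝕀_P = G(ℍ)` for any LGS (Coefficient Lemma, `μ(P) = ∞`; `level_le_iSup_span_hPow`); Steps 2–4 level by
level (`exists_rsop_isLGS_pow`: claim (◇) by the case analysis with the Hasse–Schmidt operators along a regular system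
of parameters, then Krull over `F^{e_u}(R_P)`), the invariance of `μ = ∞` under change of LGS being Prop. 3.1.2.1
(`muTilde_eq_of_isLGS`); finally the indices are sorted (`e_1 ≤ ⋯ ≤ e_N`) and the regular parameters permuted so that
the LGS coordinates come first. `dim R_P = d = dim A` by `Resolution.height_eq_ringKrullDim_of_isMaximal`. This is
the statement of the named fact `KawanoueMatsuki2010_thm_A_1_1_1_part1` (`InvariantsAtClosedPoint.lean`) with
`muTildeAt` unfolded. [cite: KawanoueMatsuki2010, Thm. A.1.1.1 (1)] -/
theorem exists_rsop_isLGS_generate (p : ℕ) (k : Type u) [Field k] [IsAlgClosed k] [ExpChar k p]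
    (A : Type u) [CommRing A] [IsDomain A] [Algebra k A] [Algebra.FiniteType k A] [Algebra.Smooth k A]
    (d : ℕ) (hdim : ringKrullDim A = d) (𝕀 : IdealisticFiltration A)
    (hD : IdealisticFiltration.IsDSaturated k 𝕀) (𝔫 : Ideal A) [𝔫.IsMaximal] {ι : Type} [Finite ι]
    (h : ι → Localization.AtPrime 𝔫) (e : ι → ℕ) (H : IsLGS p (𝕀.atPrime 𝔫) h e)
    (hμ : muTilde (𝕀.atPrime 𝔫) h = ⊤) :
    ∃ (x : Fin d → Localization.AtPrime 𝔫) (N : ℕ) (hN : N ≤ d) (e' : Fin N → ℕ),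
      Ideal.span (Set.range x) = maximalIdeal (Localization.AtPrime 𝔫) ∧
      (maximalIdeal (Localization.AtPrime 𝔫)).spanFinrank = d ∧
      Monotone e' ∧
      IsLGS p (𝕀.atPrime 𝔫) (fun l : Fin N => x (Fin.castLE hN l) ^ p ^ e' l) e' ∧
      𝕀.atPrime 𝔫 = IdealisticFiltration.generate
        (Set.range fun l : Fin N => (x (Fin.castLE hN l) ^ p ^ e' l, ((p ^ e' l : ℕ) : ℝ))) := by
  classical
  haveI : IsRegularLocalRing (Localization.AtPrime 𝔫) := isRegularLocalRing_of_isSmoothAt k A 𝔫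
  haveI : ExpChar (Localization.AtPrime 𝔫) p :=
    expChar_of_injective_algebraMap (algebraMap k (Localization.AtPrime 𝔫)).injective p
  haveI : Algebra.EssFiniteType A (Localization.AtPrime 𝔫) :=
    Algebra.EssFiniteType.of_isLocalization (Localization.AtPrime 𝔫) 𝔫.primeCompl
  haveI : Algebra.EssFiniteType k (Localization.AtPrime 𝔫) :=
    Algebra.EssFiniteType.comp k A (Localization.AtPrime 𝔫)
  haveI : Algebra.FormallySmooth A (Localization.AtPrime 𝔫) :=
    Algebra.FormallySmooth.of_isLocalization 𝔫.primeCompl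
  haveI : Algebra.FormallySmooth k (Localization.AtPrime 𝔫) :=
    Algebra.FormallySmooth.comp k A (Localization.AtPrime 𝔫)
  haveI : Fintype ι := Fintype.ofFinite ι
  have hD' : (𝕀.atPrime 𝔫).IsDSaturated k := hD.atPrime k 𝔫
  -- Steps 2–4 (prime characteristic) / the characteristic-zero case
  have main : ∃ (d₀ : ℕ) (x : Fin d₀ → Localization.AtPrime 𝔫) (v : ι → Fin d₀),
      (maximalIdeal (Localization.AtPrime 𝔫)).spanFinrank = d₀ ∧
      Ideal.span (Set.range x) = maximalIdeal (Localization.AtPrime 𝔫) ∧ Function.Injective v ∧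
      IsLGS p (𝕀.atPrime 𝔫) (fun l => x (v l) ^ p ^ e l) e ∧
      muTilde (𝕀.atPrime 𝔫) (fun l => x (v l) ^ p ^ e l) = ⊤ := by
    cases ‹ExpChar k p› with
    | zero => exact exists_rsop_isLGS_pow_one (𝕀.atPrime 𝔫) H hμ
    | prime hp =>
      haveI : Fact p.Prime := ⟨hp⟩
      haveI : CharP (Localization.AtPrime 𝔫) p :=
        charP_of_injective_algebraMap (algebraMap k (Localization.AtPrime 𝔫)).injective p
      exact exists_rsop_isLGS_pow p (𝕀.atPrime 𝔫) (exists_sub_algebraMap_mem k A 𝔫) hD' H hμ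
  obtain ⟨d₀, x, v, hd₀, hx, hv, HL, hμL⟩ := main
  -- `d₀ = d = dim A`
  have hd₀d : d₀ = d := by
    have h1 : (((maximalIdeal (Localization.AtPrime 𝔫)).spanFinrank : ℕ∞) : WithBot ℕ∞) =
        ringKrullDim (Localization.AtPrime 𝔫) := IsRegularLocalRing.spanFinrank_maximalIdeal
    have h2 : ringKrullDim (Localization.AtPrime 𝔫) = 𝔫.height :=
      IsLocalization.AtPrime.ringKrullDim_eq_height 𝔫 (Localization.AtPrime 𝔫)
    have h3 : (𝔫.height : WithBot ℕ∞) = ringKrullDim A := height_eq_ringKrullDim_of_isMaximal k 𝔫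
    have h4 : (((d₀ : ℕ) : ℕ∞) : WithBot ℕ∞) = (d : WithBot ℕ∞) := by
      rw [← hd₀, h1, h2, h3, hdim]
    exact_mod_cast h4
  subst hd₀d
  -- sort the indices by level and permute the regular parameters
  set N := Fintype.card ι with hNdef
  have hN : N ≤ d₀ := by simpa using Fintype.card_le_of_injective v hv
  let σ₀ : ι ≃ Fin N := Fintype.equivFin ι
  let e₁ : Fin N → ℕ := e ∘ σ₀.symm
  let τ : Fin N ≃ ι := (Tuple.sort e₁).trans σ₀.symm
  have hmono : Monotone (e ∘ τ) := Tuple.monotone_sort e₁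
  have hv' : Function.Injective (v ∘ τ) := hv.comp τ.injective
  let ε₀ : {t // t ∈ Set.range (Fin.castLE hN)} ≃ {t // t ∈ Set.range (v ∘ τ)} :=
    (Equiv.ofInjective _ (Fin.castLE_injective hN)).symm.trans (Equiv.ofInjective _ hv')
  let ρ : Equiv.Perm (Fin d₀) := ε₀.extendSubtype
  have hρ : ∀ l, ρ (Fin.castLE hN l) = v (τ l) := by
    intro l
    have h1 := Equiv.extendSubtype_apply_of_mem ε₀ (Fin.castLE hN l) ⟨l, rfl⟩
    rw [h1]
    simp only [ε₀, Equiv.trans_apply, Equiv.ofInjective_symm_apply, Equiv.ofInjective_apply,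
      Function.comp_apply]
  -- the final family and its LGS property (reindexing) and `μ = ∞` (Prop. 3.1.2.1)
  set F' : Fin N → Localization.AtPrime 𝔫 := fun l => (x ∘ ρ) (Fin.castLE hN l) ^ p ^ (e ∘ τ) l with hF'
  have hfam : F' = (fun l => x (v l) ^ p ^ e l) ∘ τ :=
    funext fun l => by simp only [hF', Function.comp_apply, hρ]
  have Hfin : IsLGS p (𝕀.atPrime 𝔫) F' (e ∘ τ) := by rw [hfam]; exact isLGS_comp_equiv p _ HL τ
  have hμfin : muTilde (𝕀.atPrime 𝔫) F' = ⊤ := by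
    rw [← muTilde_eq_of_isLGS (k := k) p (𝕀.atPrime 𝔫) hD' HL Hfin]; exact hμL
  refine ⟨x ∘ ρ, N, hN, e ∘ τ, ?_, hd₀, hmono, Hfin, ?_⟩
  · rw [ρ.surjective.range_comp]; exact hx
  · -- Step 1: `𝕀_P = G(ℍ)`
    refine IdealisticFiltration.Incl.antisymm ?_ (IdealisticFiltration.generate_incl ?_)
    swap
    · rintro _ ⟨l, rfl⟩
      exact (IdealisticFiltration.mem_carrier_iff _ _).mpr (Hfin.level_mem l)
    intro a f hfa
    refine IdealisticFiltration.mem_level_inter_iff.mpr fun 𝕁 h𝕁 => ?_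
    have hlevJ : ∀ l, F' l ∈ 𝕁.level ((p ^ (e ∘ τ) l : ℕ) : ℝ) :=
      fun l => (IdealisticFiltration.mem_carrier_iff _ _).mp (h𝕁 ⟨l, rfl⟩)
    have h1 := level_le_iSup_span_hPow p F' (e ∘ τ) (𝕀.atPrime 𝔫) hD' Hfin.isWeakLGS hμfin a hfa
    have hI₀J : (⨆ (B : Fin N →₀ ℕ) (_ : a ≤ (bracketDeg p (e ∘ τ) B : ℝ)), Ideal.span {hPow F' B}) ≤
        𝕁.level a := iSup₂_le fun B hB => by
      rw [Ideal.span_singleton_le_iff_mem]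
      exact 𝕁.mem_of_le hB (hPow_mem_level p F' (e ∘ τ) 𝕁 hlevJ B)
    exact hI₀J h1

end AtPrime

end Literature.AlgebraicGeometry.KawanoueMatsuki2010

end
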